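import Literature.NumberTheory.Sieve.BombieriFriedlanderIwaniecTheorem1Terms
import Literature.NumberTheory.Sieve.BombieriFriedlanderIwaniecLemma6
import HarnessLib

/-!
# Bombieri–Friedlander–Iwaniec 1986, Theorem 1: the assembly (Theorem 1 from Lemma 6 / Lemma 1)

Topic `Literature/NumberTheory/Sieve`.  Final file of the formalisation of the provable part of the
proof of **Theorem 1** (the named fact `Literature.NumberTheory.Sieve.BombieriFriedlanderIwaniecTheorem1`)
of E. Bombieri, J. B. Friedlander, H. Iwaniec, *Primes in arithmetic progressions to large moduli*,
Acta Math. 156 (1986), 203–251.  The seven files `…DispersionSmoothing` (§3), `…DispersionS3`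
(§4), `…DispersionS2` (§5), `…DispersionS1`, `…DispersionS1Rest` (§6), `…DispersionMainTerm`
(§7) and `…Theorem1R1` (§8 up to (8.2)) proved Linnik's dispersion method for `𝒢(M,N,Q,R)` with
every error explicit; `…Lemma6` proved Lemma 6 ((8.4), p. 227) from Lemma 1 (§2, p. 210 =
Deshouillers–Iwaniec, Invent. Math. 70 (1982), Theorem 12, which is in neither Mathlib nor the
tree).  The file
`…Theorem1Terms` combined the errors (`BFI.dispG_le_struct`, the main terms `𝓕f(0)·X` cancelling
exactly in `𝒮₁ − 2𝒮₂ + 𝒮₃`, (3.4) p. 214) and brought each to a closed form (p. 223: "Gathering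
together (7.1) and the results of Sections 4 and 5 one completes the dispersion method getting
`𝒢 ≪ ‖β‖²NR⁻¹{N + xℒ^{−A}} + ℛ`"; p. 227: (8.2), (8.4)–(8.6)).  Here:

1. **`BFI.theorem1_struct`** — Theorem 1 with every constant explicit and every analytic input
   (Lemma 3 = Shiu twice, Theorem 0 (a) = Barban–Davenport–Halberstam for (A₂)-sequences, Lemma 6,
   the divisor bound, the divisor moments) as a hypothesis of its exact shape, in the polynomial
   ranges `t = x^{ε/8}`;
2. **`BombieriFriedlanderIwaniecTheorem1_of_lemma6`** — the named fact from BFI's Lemma 6 taken as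
   a hypothesis (the same hypothesis as `BombieriFriedlanderIwaniecTheorem5_of_lemma6`), all other
   inputs being PROVED in the tree (`BombieriFriedlanderIwaniecLemma3_holds`,
   `BombieriFriedlanderIwaniecTheorem0a`, `DivisorBound`, `DivisorPowerSums`), with the choice of
   parameters of pp. 220, 227 (`Q₀, N₀ = ℒ^{O_{ε,A,B}(1)}` (6.5), `H = ⌊16tQ²R/M⌋`, `ε' = min(ε, 1/100)`);
3. **`BombieriFriedlanderIwaniecTheorem1_of_lemma1`** — the named fact from Lemma 1 alone
   (`BFI.Lemma1BoundFor BFI.plateau2 (5/4)`), through `BFI.L6.dispA_le_of_lemma1`.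

Everything is PROVED; no named facts are introduced.  What remains unproved in the tree for
`BombieriFriedlanderIwaniecTheorem1` (and Theorems 5, 5*) is exactly BFI's Lemma 1.

## Contents

* **`BFI.theorem1_struct`** (Theorem 1 with explicit constants, all inputs as hypotheses).
* `BFI.eventually_const_mul_log_rpow_le_rpow`, `BFI.sqrt_le_add_one`, `BFI.rpow_npow`,
  `BFI.theorem1_ranges` (the ranges of Theorem 1, p. 225 and (8.5)–(8.6), in polynomial form).
* **`BombieriFriedlanderIwaniecTheorem1_of_lemma6`**, **`BombieriFriedlanderIwaniecTheorem1_of_lemma1`**.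

## References

* E. Bombieri, J. B. Friedlander, H. Iwaniec, Acta Math. 156 (1986), 203–251, §3 p. 214, §§4–8
  pp. 216–227, Theorem 1 p. 225, Lemma 6 p. 227, Lemma 1 p. 210. [BombieriFriedlanderIwaniecActa1986]
* J.-M. Deshouillers, H. Iwaniec, *Kloosterman sums and Fourier coefficients of cusp forms*,
  Invent. Math. 70 (1982), 219–288, Theorem 12 (BFI's Lemma 1; hypothesis only).
-/

noncomputable section

open Finset Real MeasureTheory
open scoped ArithmeticFunction.sigma FourierTransform ComplexConjugate

namespace Literature.NumberTheory.Sieve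

namespace BFI

/-! ### The structural Theorem 1: all inputs as hypotheses, every constant explicit -/

set_option maxHeartbeats 1600000 in -- the assembly of six error terms with ~40 hypotheses
open Classical in
/-- **Theorem 1 with explicit constants and all inputs as hypotheses** (BFI pp. 223, 227:
"Gathering together (7.1) and the results of Sections 4 and 5 … `𝒢 ≪ ‖β‖²NR⁻¹{N + xℒ^{−A}} + ℛ`",
"(8.2), (8.4)–(8.6) … This completes the proof of Theorem 1").  Parameters: `t` (playing
`x^{ε/8}`), the truncations `Q₀` and `H = ⌊16tQ²R/M⌋`, the sieve level `z`, the decay order `j`;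
hypotheses: the ranges of Theorem 1 in polynomial form, the divisor bound `τ ≤ D` below `X_d`, the
logarithmic divisor sums `S_L`, two instances of Lemma 3 (`hL3`, `hL3'`), Theorem 0 (a) at level
`2Q₀R` in pre-divided form (`hBDH`), Lemma 6 on the boxes `(4NQ, 2N, 2N/R, h, 2Q)` (`hA6`), and the
numeric largeness conditions (`hW…`, savings `hQ₀big`, `hzbig`, tails).  Conclusion:
`𝒢(M,N,Q,R) ≤ C_tot ‖β‖² x/(R (log x)^A)` with `C_tot` an absolute numeric multiple of the input
constants. [cite: BombieriFriedlanderIwaniecActa1986, §8 Theorem 1 pp. 225–227] -/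
theorem theorem1_struct (a : ℤ) {x t M N Q R Q₀ z A B D Xd SL C₃ B₃ X₀ ε₃ C₄ B₄ X₀' ε₃' Cb CE ηE : ℝ}
    {k₀ j : ℕ} (β γ : ℕ → ℝ)
    -- ranges (polynomial in `t = x^{ε/8}`)
    (hx : 3 ≤ x) (ht : 2 ≤ t) (hbig : (10 : ℝ) ^ 7 ≤ t ^ 2) (hMN : M * N = x) (hN : 1 ≤ N)
    (htM : t ^ 8 ≤ M) (htN : t ^ 8 ≤ N) (hQ : 1 / 2 ≤ Q) (hR : 1 / 2 ≤ R) (hRN : R * t ^ 8 ≤ N)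
    (h85 : N ^ 2 * Q * t ^ 16 ≤ x) (hii : N ^ 2 * Q ^ 4 * R * t ^ 16 ≤ x ^ 2)
    (hiii : N * Q ^ 5 * R * t ^ 8 ≤ x ^ 2) (hNQR : N * Q * R * t ^ 24 ≤ x)
    -- coefficients
    (hA : 0 ≤ A) (hB : 0 ≤ B) (hγ : ∀ q, |γ q| ≤ (σ 0 q : ℝ) ^ B) (hz : 1 ≤ z)
    (hsift : IsSifted (dyadic N) z β) (hQ₀ : 1 ≤ Q₀) (hat : 2 * |(a : ℝ)| + 2 ≤ t ^ 8)
    -- divisor bound and logarithmic divisor sums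
    (hD : ∀ n : ℕ, n ≠ 0 → (n : ℝ) ≤ Xd → (σ 0 n : ℝ) ≤ D) (hXd : 8 * x ^ 3 ≤ Xd)
    (hSL : ∀ X : ℝ, 1 ≤ X → X ≤ 2 * x → ∑ n ∈ Finset.Icc 1 ⌊X⌋₊, (σ 0 n : ℝ) ^ k₀ / n ≤ SL)
    (hSL1 : 1 ≤ SL) (hk1 : 2 * B + 2 ≤ k₀) (hk2 : B + 1 + B₃ + B₄ ≤ k₀)
    -- Lemma 3, twice
    (hC₃ : 0 ≤ C₃) (hB₃ : 0 ≤ B₃) (hC₄ : 0 ≤ C₄) (hB₄ : 0 ≤ B₄)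
    (hL3 : ∀ X : ℝ, X₀ ≤ X → ∀ k : ℕ, 0 < k → (k : ℝ) ≤ X ^ (1 - ε₃) → ∀ l : ZMod k,
      ∑ v ∈ l3Set a X k l, l3Term a (B + 1) v ≤ C₃ * (X / k) * ((σ 0 k : ℝ) * Real.log X) ^ B₃)
    (hL3' : ∀ X : ℝ, X₀' ≤ X → ∀ k : ℕ, 0 < k → (k : ℝ) ≤ X ^ (1 - ε₃') → ∀ l : ZMod k,
      ∑ v ∈ l3Set a X k l, l3Term a B₃ v ≤ C₄ * (X / k) * ((σ 0 k : ℝ) * Real.log X) ^ B₄)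
    (hX₀ : X₀ ≤ x) (hX₀' : X₀' ≤ t ^ 8)
    (hpow1 : ∀ y : ℝ, x ≤ y → y ≤ 5 * x → y / t ≤ y ^ (1 - ε₃))
    (hpow2 : ∀ y : ℝ, 1 ≤ y → y ≤ 3 * x → y / (2 * t ^ 8) ≤ y ^ (1 - ε₃'))
    -- Theorem 0 (a) at level `2Q₀R`, pre-divided
    (hCb : 0 ≤ Cb)
    (hBDH : ∀ d : ℕ, 1 ≤ d → ∑ q ∈ Finset.Icc 1 ⌊2 * Q₀ * R⌋₊, bdhD N β d q ≤
      Cb * (σ 0 d : ℝ) ^ B * l2Sq N β * N / (Q₀ * SL ^ 2 * Real.log x ^ A))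
    -- Lemma 6 on the boxes `(4NQ, 2N, 2N/R, h, 2Q)`, both signs
    (hCE : 0 ≤ CE) (hηE : 0 ≤ ηE)
    (hA6 : ∀ h : ℝ, 1 ≤ h → ∀ s ∈ ({1, -1} : Finset ℤ), ∀ α : ℕ → ℕ → ℂ, (∀ h' q, ‖α h' q‖ ≤ 1) →
      dispA (a * s) (4 * N * Q) (2 * N) (2 * N / R) h (2 * Q) α ≤
        CE * (((4 * N * Q) * (2 * N) * h * (2 * N / R) * (2 * Q)) ^ ηE *
          ((4 * N * Q) * (2 * N) * h * (2 * N / R) * (2 * Q) +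
            h * ((2 * N / R) * (2 * Q)) ^ (1 / 2 : ℝ) * (h + 2 * Q) ^ (1 / 2 : ℝ) *
              ((4 * N * Q) * ((2 * Q) ^ 2 + h * (2 * N / R) * (2 * Q)) * ((4 * N * Q) + (2 * N) * (2 * Q) ^ 2) +
                (4 * N * Q) ^ 2 * (2 * N) * (2 * Q) * ((2 * Q) ^ 2 + h * (2 * N / R) * (2 * Q)) ^ (1 / 2 : ℝ) +
                (2 * N) ^ 2 * h * (2 * N / R) * (2 * Q) ^ 3) ^ (1 / 2 : ℝ))))
    -- numeric largeness (all in terms of `x`, `t` and the constants)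
    (hj : 2 ≤ j)
    (htail1 : 3072 * derivConst j * ((D ^ B) ^ 2 * D ^ 3) * x ^ 2 * Real.log x ^ A ≤ t ^ (22 * j))
    (htail2 : 26112 * derivConst j * ((D ^ B) ^ 2 * D ^ 3) * x ^ 8 * t * Real.log x ^ A ≤ t ^ j)
    (hW : ((D ^ B) ^ 2 * D ^ 3) * Q₀ ^ 2 * SL ^ 2 * (3 * Real.log (5 * x) + 1) ^ 2 * (|(a : ℝ)| + 1) *
        (15 * Real.sqrt (3 * CE * (x ^ 3) ^ ηE) + 1) * Real.log x ^ A ≤ t)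
    (hQ₀big : (6 * SL ^ 3 + 5 * C₃ * C₄ * Real.log (5 * x) ^ B₃ * Real.log (5 * x) ^ B₄ * SL ^ 2) *
        Real.log x ^ A ≤ Q₀)
    (hzbig : (48 * Real.log (5 * x) * SL ^ 2 +
        15 * Real.log (5 * x) * C₃ * C₄ * (2 * Real.log (5 * x)) ^ B₃ * Real.log (5 * x) ^ B₄ * SL ^ 2) *
        Real.log x ^ A ≤ z) :
    dispG a M N Q R β γ ≤
      (2 * Cb + 192 * (8 + derivConst 2) + 5000 + 40 * C₃ * C₄ + 1) *
        (x * l2Sq N β / (R * Real.log x ^ A)) := by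
  /- Step 0: elementary consequences of the ranges -/
  have hx1 : 1 ≤ x := by linarith only [hx]
  have hx0 : 0 < x := by linarith only [hx]
  have ht1 : 1 ≤ t := by linarith only [ht]
  have ht0 : 0 < t := by linarith only [ht]
  have hN0 : 0 < N := by linarith only [hN]
  have hQ0 : 0 < Q := by linarith only [hQ]
  have hR0 : 0 < R := by linarith only [hR]
  have ht8 : (256 : ℝ) ≤ t ^ 8 := by
    have := pow_le_pow_left₀ (by norm_num : (0:ℝ) ≤ 2) ht 8
    norm_num at this
    exact this
  have hM1 : 1 ≤ M := le_trans (by linarith only [ht8]) htM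
  have hM0 : 0 < M := by linarith only [hM1]
  have hMx : M ≤ x := by
    calc M = M * 1 := (mul_one M).symm
      _ ≤ M * N := mul_le_mul_of_nonneg_left hN hM0.le
      _ = x := hMN
  have hNx : N ≤ x := by
    calc N = 1 * N := (one_mul N).symm
      _ ≤ M * N := mul_le_mul_of_nonneg_right hM1 hN0.le
      _ = x := hMN
  have hNt8 : N * t ^ 8 ≤ x := by
    calc N * t ^ 8 ≤ N * M := mul_le_mul_of_nonneg_left htM hN0.le
      _ = x := by rw [mul_comm, hMN]
  have hRN' : R ≤ N / t ^ 8 := by rw [le_div_iff₀ (by positivity)]; exact hRN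
  have hRNle : R ≤ N := le_trans hRN' (div_le_self hN0.le (one_le_pow₀ ht1))
  have hRx : R ≤ x := hRNle.trans hNx
  have hQx : Q ≤ x := by
    have h1 : Q * 1 ≤ Q * (N ^ 2 * t ^ 16) :=
      mul_le_mul_of_nonneg_left (one_le_mul_of_one_le_of_one_le (one_le_pow₀ hN) (one_le_pow₀ ht1)) hQ0.le
    nlinarith only [h1, h85]
  have hQRM : Q * R * t ^ 24 ≤ M := by
    have : N * (Q * R * t ^ 24) ≤ N * M := by nlinarith only [hNQR, hMN]
    exact le_of_mul_le_mul_left this hN0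
  have hQRM' : Q * R ≤ M / t ^ 24 := by rw [le_div_iff₀ (by positivity)]; exact hQRM
  have hlogx : 1 ≤ Real.log x := by
    rw [Real.le_log_iff_exp_le hx0]
    exact le_trans (le_of_lt Real.exp_one_lt_d9) (by norm_num; linarith only [hx])
  have hlogx0 : 0 < Real.log x := by linarith only [hlogx]
  set ℒ : ℝ := Real.log x with hLdef
  set L₁ : ℝ := Real.log (5 * x) with hL₁
  have hL₁ℒ : ℒ ≤ L₁ := Real.log_le_log hx0 (by linarith only [hx0])
  have hL₁1 : 1 ≤ L₁ := hlogx.trans hL₁ℒ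
  have hl : 0 ≤ l2Sq N β := Finset.sum_nonneg fun _ _ => sq_nonneg _
  set F : ℝ := x * l2Sq N β / (R * ℒ ^ A) with hF
  have hF0 : 0 ≤ F := by positivity
  -- divisor bound consequences
  have hσ1 : (1 : ℝ) ≤ D := by
    have h := hD 1 one_ne_zero (by push_cast; nlinarith only [pow_pos hx0 3, hXd, one_le_pow₀ (M₀ := ℝ) hx1 (n := 3)])
    have : (1 : ℝ) ≤ (σ 0 1 : ℝ) := by exact_mod_cast one_le_sigma_zero one_ne_zero
    exact this.trans h
  have hD0 : 0 < D := by linarith only [hσ1]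
  have hDB : 1 ≤ D ^ B := Real.one_le_rpow hσ1 hB
  set Dp : ℝ := (D ^ B) ^ 2 * D ^ 3 with hDp
  have hDp1 : 1 ≤ Dp := one_le_mul_of_one_le_of_one_le (one_le_pow₀ hDB) (one_le_pow₀ hσ1)
  have h8Q2R : 8 * Q ^ 2 * R ≤ Xd := by
    refine le_trans ?_ hXd
    have : Q ^ 2 * R ≤ x ^ 2 * x := mul_le_mul (pow_le_pow_left₀ hQ0.le hQx 2) hRx hR0.le (by positivity)
    nlinarith only [this]
  have hD8 : ∀ n : ℕ, n ≠ 0 → (n : ℝ) ≤ 8 * Q ^ 2 * R → (σ 0 n : ℝ) ≤ D := fun n hn h => hD n hn (h.trans h8Q2R)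
  -- the polylog quantities
  have hSLQ : ∑ n ∈ Finset.Icc 1 ⌊2 * Q⌋₊, (σ 0 n : ℝ) ^ k₀ / n ≤ SL :=
    hSL (2 * Q) (by linarith only [hQ]) (by linarith only [hQx])
  have hSLR : ∑ n ∈ Finset.Icc 1 ⌊2 * R⌋₊, (σ 0 n : ℝ) ^ k₀ / n ≤ SL :=
    hSL (2 * R) (by linarith only [hR]) (by linarith only [hRx])
  have hSL0 : 0 ≤ SL := by linarith only [hSL1]
  /- Step 1: the structural combination with `Y = M/2`, `V = t`, `H = ⌊16 t Q² R / M⌋`. -/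
  set H : ℕ := ⌊16 * t * Q ^ 2 * R / M⌋₊ with hHdef
  set T₂ : ℝ := 8 * derivConst j * M / t ^ (22 * j) with hT₂
  have hT₂0 : 0 ≤ T₂ := by have := one_le_derivConst j; positivity
  have hj1 : 1 ≤ j := by omega
  have htailS2 : ∀ q₁ ∈ dyadic Q, ∀ q₂ ∈ dyadic Q, ∀ r ∈ dyadic R, ∀ ν ∈ q₂.divisors, (ν : ℝ) ≤ t →
      ((ν : ℝ) * (q₁ * r : ℕ))⁻¹ * tailBound (M / 2) j (ν * (q₁ * r)) 0 ≤ T₂ := by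
    intro q₁ hq₁ q₂ hq₂ r hr ν hν hνt
    have hν0 : 0 < ν := Nat.pos_of_mem_divisors hν
    have hq₁0 := pos_of_mem_dyadic hQ0.le hq₁
    have hr0 := pos_of_mem_dyadic hR0.le hr
    have hL : (((ν * (q₁ * r) : ℕ) : ℕ) : ℝ) ≤ 4 * t * Q * R := by
      push_cast
      have h1 := dyadic_le_two_mul hQ0.le hq₁
      have h2 := dyadic_le_two_mul hR0.le hr
      have : (0 : ℝ) ≤ ν := by positivity
      calc (ν : ℝ) * ((q₁ : ℝ) * r) ≤ t * ((2 * Q) * (2 * R)) := by gcongr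
        _ = 4 * t * Q * R := by ring
    have htb := tail_S2_le hM0 ht hQRM hj1 hL
    have hinv : ((ν : ℝ) * (q₁ * r : ℕ))⁻¹ ≤ 1 := by
      refine inv_le_one_of_one_le₀ ?_
      have : (1 : ℝ) ≤ ((ν * (q₁ * r) : ℕ) : ℝ) := by exact_mod_cast Nat.mul_pos hν0 (Nat.mul_pos hq₁0 hr0)
      push_cast at this ⊢
      linarith only [this]
    have ht0' : 0 ≤ tailBound (M / 2) j (ν * (q₁ * r)) 0 := tailBound_nonneg (by positivity) _ _ _
    calc ((ν : ℝ) * (q₁ * r : ℕ))⁻¹ * tailBound (M / 2) j (ν * (q₁ * r)) 0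
        ≤ 1 * tailBound (M / 2) j (ν * (q₁ * r)) 0 := mul_le_mul_of_nonneg_right hinv ht0'
      _ ≤ T₂ := by rw [one_mul]; exact htb
  have hmain := dispG_le_struct a (M := M) (Y := M / 2) (by positivity) (by linarith only [hM0]) hN0.le hQ0.le hR0.le
    Q₀ β γ H hj ht1 htailS2 hz hsift
  /- Step 2: the conversion to the final currency and the budget `W`. -/
  have hconv : ∀ Z : ℝ, 0 ≤ Z → Z * R * ℒ ^ A ≤ x → Z * l2Sq N β ≤ F := by
    intro Z hZ0 hZ
    rw [hF, le_div_iff₀ (by positivity)]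
    calc Z * l2Sq N β * (R * ℒ ^ A) = (Z * R * ℒ ^ A) * l2Sq N β := by ring
      _ ≤ x * l2Sq N β := mul_le_mul_of_nonneg_right hZ hl
  set W : ℝ := Dp * Q₀ ^ 2 * SL ^ 2 * (3 * L₁ + 1) ^ 2 * (|(a : ℝ)| + 1) *
    (15 * Real.sqrt (3 * CE * (x ^ 3) ^ ηE) + 1) with hWdef
  have hℒA : 1 ≤ ℒ ^ A := Real.one_le_rpow hlogx hA
  have hWt : W * ℒ ^ A ≤ t := hW
  have f1 : 1 ≤ Q₀ ^ 2 := one_le_pow₀ hQ₀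
  have f2 : 1 ≤ SL ^ 2 := one_le_pow₀ hSL1
  have f3 : 1 ≤ (3 * L₁ + 1) ^ 2 := one_le_pow₀ (by linarith only [hL₁1])
  have f4 : 1 ≤ |(a : ℝ)| + 1 := by have := abs_nonneg (a : ℝ); linarith only [this]
  have f5 : 1 ≤ 15 * Real.sqrt (3 * CE * (x ^ 3) ^ ηE) + 1 := by
    have := Real.sqrt_nonneg (3 * CE * (x ^ 3) ^ ηE); linarith only [this]
  -- sub-budgets
  have hWsub : ∀ P : ℝ, P ≤ W → P * ℒ ^ A ≤ t := fun P hP =>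
    le_trans (mul_le_mul_of_nonneg_right hP (by positivity)) hWt
  have wDp : Dp * ℒ ^ A ≤ t := by
    refine hWsub Dp ?_
    rw [hWdef]
    have h0 : 0 ≤ Dp := by positivity
    calc Dp = Dp * 1 * 1 * 1 * 1 * 1 := by ring
      _ ≤ Dp * Q₀ ^ 2 * SL ^ 2 * (3 * L₁ + 1) ^ 2 * (|(a : ℝ)| + 1) *
          (15 * Real.sqrt (3 * CE * (x ^ 3) ^ ηE) + 1) := by gcongr
  /- Step 3: the error of `𝒮₃`. -/
  have hT6 : (2 * (M + 2 * (M / 2)) / (M / 2) + derivConst 2) *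
      ∑ r ∈ dyadic R, ∑ q₁ ∈ dyadic Q, ∑ q₂ ∈ dyadic Q,
        |γ q₁| * |γ q₂| * (σ 0 (q₁ * q₂ * r) : ℝ) * (∑ n ∈ dyadic N, |β n|) ^ 2 /
          ((Nat.totient (q₁ * r) : ℝ) * (Nat.totient (q₂ * r) : ℝ)) ≤
      (192 * (8 + derivConst 2)) * F := by
    refine (errS3_le hM0 hN hQ hR hB hσ1 hD8 hγ β).trans ?_
    rw [mul_assoc]
    refine mul_le_mul_of_nonneg_left ?_ (by have := one_le_derivConst 2; positivity)
    rw [show (D ^ B) ^ 2 * D ^ 3 * (N * l2Sq N β / R) = (Dp * N / R) * l2Sq N β by rw [hDp]; ring]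
    refine hconv _ (by positivity) ?_
    calc Dp * N / R * R * ℒ ^ A = (Dp * ℒ ^ A) * N := by field_simp
      _ ≤ t * N := mul_le_mul_of_nonneg_right wDp hN0.le
      _ ≤ t ^ 8 * N := by
          refine mul_le_mul_of_nonneg_right ?_ hN0.le
          calc t = t ^ 1 := (pow_one t).symm
            _ ≤ t ^ 8 := pow_le_pow_right₀ ht1 (by norm_num)
      _ ≤ x := by rw [mul_comm]; exact hNt8
  -- numeric facts about `t`
  have htn : ∀ n : ℕ, 2 ≤ n → (10 : ℝ) ^ 7 ≤ t ^ n := fun n hn => hbig.trans (pow_le_pow_right₀ ht1 hn)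
  have htn1 : ∀ n : ℕ, 1 ≤ n → t ≤ t ^ n := fun n hn => by
    calc t = t ^ 1 := (pow_one t).symm
      _ ≤ t ^ n := pow_le_pow_right₀ ht1 hn
  have hDpD2 : (D ^ B) ^ 2 * D ^ 2 ≤ Dp := by
    rw [hDp]; exact mul_le_mul_of_nonneg_left (pow_le_pow_right₀ hσ1 (by norm_num)) (by positivity)
  have hDpD0 : (D ^ B) ^ 2 ≤ Dp := by
    rw [hDp]
    calc (D ^ B) ^ 2 = (D ^ B) ^ 2 * 1 := (mul_one _).symm
      _ ≤ (D ^ B) ^ 2 * D ^ 3 := mul_le_mul_of_nonneg_left (one_le_pow₀ hσ1) (by positivity)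
  have hKj := one_le_derivConst j
  /- Step 4: the error of `𝒮₂`. -/
  have hT₂1 : T₂ ≤ 1 := by
    rw [hT₂, div_le_one (by positivity)]
    refine le_trans ?_ htail1
    -- `8 K_j M ≤ 3072 K_j Dp x² ℒ^A`
    have h1 : M ≤ x ^ 2 := by nlinarith only [hMx, hx1, hM0]
    calc 8 * derivConst j * M ≤ 8 * derivConst j * x ^ 2 := by gcongr
      _ = 8 * derivConst j * 1 * x ^ 2 * 1 := by ring
      _ ≤ 3072 * derivConst j * Dp * x ^ 2 * ℒ ^ A := by gcongr; norm_num
  have hT5 : 2 * (∑ r ∈ dyadic R, ∑ q₁ ∈ dyadic Q, ∑ q₂ ∈ dyadic Q,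
        |γ q₁| * |γ q₂| * (∑ n ∈ dyadic N, |β n|) ^ 2 *
          ((σ 0 q₂ : ℝ) / (Nat.totient (q₂ * r) : ℝ)) *
          (T₂ + (3 * M + 3 * (M / 2)) / (t * (q₁ * r : ℕ)) + 1)) ≤ 1729 * F := by
    refine (errS2_le hM0 hN hQ hR hB hσ1 hD8 ht0 hT₂0 hγ β).trans ?_
    have e : 384 * ((D ^ B) ^ 2 * D ^ 2) * l2Sq N β * ((T₂ + 1) * N * Q + 9 * M * N / (2 * t * R)) =
        (384 * ((D ^ B) ^ 2 * D ^ 2) * ((T₂ + 1) * N * Q)) * l2Sq N β +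
        (1728 * ((D ^ B) ^ 2 * D ^ 2) * (x / (t * R))) * l2Sq N β := by
      rw [← hMN]; field_simp; ring
    rw [e, show (1729 : ℝ) * F = 1 * F + 1728 * F by ring]
    refine add_le_add ?_ ?_
    · rw [one_mul]
      refine hconv _ (by positivity) ?_
      have h23 : (768 : ℝ) ≤ t ^ 23 := le_trans (by norm_num) (htn 23 (by norm_num))
      calc 384 * ((D ^ B) ^ 2 * D ^ 2) * ((T₂ + 1) * N * Q) * R * ℒ ^ A
          = 384 * (T₂ + 1) * (((D ^ B) ^ 2 * D ^ 2) * ℒ ^ A) * (N * Q * R) := by ring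
        _ ≤ 384 * (1 + 1) * (Dp * ℒ ^ A) * (x / t ^ 24) := by
            have h1 : N * Q * R ≤ x / t ^ 24 := by rw [le_div_iff₀ (by positivity)]; exact hNQR
            have h2 : ((D ^ B) ^ 2 * D ^ 2) * ℒ ^ A ≤ Dp * ℒ ^ A := mul_le_mul_of_nonneg_right hDpD2 (by positivity)
            gcongr
        _ ≤ 384 * (1 + 1) * t * (x / t ^ 24) := by gcongr
        _ = 768 * x / t ^ 23 := by field_simp; ring
        _ ≤ x := by rw [div_le_iff₀ (by positivity)]; nlinarith only [h23, hx0]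
    · rw [show 1728 * ((D ^ B) ^ 2 * D ^ 2) * (x / (t * R)) * l2Sq N β =
        1728 * ((((D ^ B) ^ 2 * D ^ 2) * (x / (t * R))) * l2Sq N β) by ring]
      refine mul_le_mul_of_nonneg_left (hconv (((D ^ B) ^ 2 * D ^ 2) * (x / (t * R))) (by positivity) ?_)
        (by norm_num)
      calc ((D ^ B) ^ 2 * D ^ 2) * (x / (t * R)) * R * ℒ ^ A = (((D ^ B) ^ 2 * D ^ 2) * ℒ ^ A) * x / t := by
            field_simp
        _ ≤ (Dp * ℒ ^ A) * x / t := by gcongr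
        _ ≤ t * x / t := by gcongr
        _ = x := by field_simp
  /- Step 5: the error of `𝒮₁ᶜ` (tails and the `H²`-term). -/
  set Tt : ℝ := 8 * derivConst j * (16 * t * Q ^ 2 * R + M) / t ^ j with hTt
  have hTt0 : 0 ≤ Tt := by positivity
  have htailS1 : ∀ L : ℕ, L ≠ 0 → (L : ℝ) ≤ 8 * Q ^ 2 * R → tailBound (M / 2) j L H ≤ Tt :=
    fun L hL0 hL => tail_S1c_le hM0 hQ0 hR0 ht1 hj1 hL0 hL
  have hT4 : (∑ r ∈ dyadic R, ∑ q₁ ∈ dyadic Q, ∑ q₂ ∈ dyadic Q, ∑ n₁ ∈ dyadic N, ∑ n₂ ∈ dyadic N,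
        if Main Q₀ q₁ q₂ n₁ n₂ ∧ Solvable a r q₁ q₂ n₁ n₂ then
          |γ q₁ * γ q₂ * β n₁ * β n₂| * errS1 a M (M / 2) j H r q₁ q₂ n₁ else 0) ≤ 2 * F := by
    refine (errS1c_le (a := a) hM0 hN hQ hR hQ₀ hB hD8 hTt0 H htailS1 hγ β).trans ?_
    have e : 192 * (D ^ B) ^ 2 * l2Sq N β *
        (Q ^ 2 * R * N * Tt + 8 * π * |(a : ℝ)| * M * (H : ℝ) ^ 2 * Q₀ ^ 2 / (Q ^ 2 * R)) =
        (192 * (D ^ B) ^ 2 * (Q ^ 2 * R * N * Tt)) * l2Sq N β +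
        (192 * (D ^ B) ^ 2 * (8 * π * |(a : ℝ)| * M * (H : ℝ) ^ 2 * Q₀ ^ 2 / (Q ^ 2 * R))) * l2Sq N β := by
      ring
    rw [e, show (2 : ℝ) * F = 1 * F + 1 * F by ring]
    refine add_le_add ?_ ?_
    · rw [one_mul]
      refine hconv _ (by positivity) ?_
      -- `Q²RN·Tt·R ≤ x⁴·8K_j(16 t x³ + x)/tʲ`
      have hQ2R : Q ^ 2 * R ≤ x ^ 3 := by
        calc Q ^ 2 * R ≤ x ^ 2 * x := mul_le_mul (pow_le_pow_left₀ hQ0.le hQx 2) hRx hR0.le (by positivity)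
          _ = x ^ 3 := by ring
      have hTtle : Tt ≤ 8 * derivConst j * (17 * t * x ^ 3) / t ^ j := by
        rw [hTt]
        refine div_le_div_of_nonneg_right (mul_le_mul_of_nonneg_left ?_ (by positivity)) (by positivity)
        have h1 : 16 * t * Q ^ 2 * R ≤ 16 * t * x ^ 3 := by
          have := mul_le_mul_of_nonneg_left hQ2R (by positivity : (0 : ℝ) ≤ 16 * t)
          calc 16 * t * Q ^ 2 * R = 16 * t * (Q ^ 2 * R) := by ring
            _ ≤ 16 * t * x ^ 3 := this
        have h2 : M ≤ t * x ^ 3 := by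
          calc M ≤ x := hMx
            _ = 1 * (x * 1) := by ring
            _ ≤ t * (x * x ^ 2) :=
                mul_le_mul ht1 (mul_le_mul_of_nonneg_left (one_le_pow₀ hx1) hx0.le) (by positivity) ht0.le
            _ = t * x ^ 3 := by ring
        calc 16 * t * Q ^ 2 * R + M ≤ 16 * t * x ^ 3 + t * x ^ 3 := add_le_add h1 h2
          _ = 17 * t * x ^ 3 := by ring
      calc 192 * (D ^ B) ^ 2 * (Q ^ 2 * R * N * Tt) * R * ℒ ^ A
          = 192 * ((D ^ B) ^ 2 * ℒ ^ A) * (Q ^ 2 * R) * N * R * Tt := by ring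
        _ ≤ 192 * (Dp * ℒ ^ A) * x ^ 3 * x * x * (8 * derivConst j * (17 * t * x ^ 3) / t ^ j) := by
            have : (D ^ B) ^ 2 * ℒ ^ A ≤ Dp * ℒ ^ A := mul_le_mul_of_nonneg_right hDpD0 (by positivity)
            gcongr
        _ = (26112 * derivConst j * Dp * x ^ 8 * t * ℒ ^ A) / t ^ j := by ring
        _ ≤ t ^ j / t ^ j := div_le_div_of_nonneg_right htail2 (by positivity)
        _ = 1 := div_self (by positivity)
        _ ≤ x := hx1
    · rw [one_mul]
      refine hconv _ (by positivity) ?_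
      have hHle : (H : ℝ) ≤ 16 * t * Q ^ 2 * R / M := Nat.floor_le (by positivity)
      have hH2 : M * (H : ℝ) ^ 2 ≤ 256 * t ^ 2 * Q ^ 4 * R ^ 2 / M := by
        have h1 : (H : ℝ) ^ 2 ≤ (16 * t * Q ^ 2 * R / M) ^ 2 := pow_le_pow_left₀ (by positivity) hHle 2
        calc M * (H : ℝ) ^ 2 ≤ M * (16 * t * Q ^ 2 * R / M) ^ 2 := mul_le_mul_of_nonneg_left h1 hM0.le
          _ = 256 * t ^ 2 * Q ^ 4 * R ^ 2 / M := by field_simp; ring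
      have h45 : (393216 * π : ℝ) ≤ t ^ 45 := by
        have hπ4 : π ≤ 4 := Real.pi_le_four
        have h1 := htn 45 (by norm_num)
        calc (393216 * π : ℝ) ≤ 393216 * 4 := by nlinarith only [hπ4]
          _ ≤ 10 ^ 7 := by norm_num
          _ ≤ t ^ 45 := h1
      have hQR2 : Q ^ 2 * R ^ 2 ≤ M ^ 2 / t ^ 48 := by
        have := pow_le_pow_left₀ (by positivity) hQRM' 2
        calc Q ^ 2 * R ^ 2 = (Q * R) ^ 2 := by ring
          _ ≤ (M / t ^ 24) ^ 2 := this
          _ = M ^ 2 / t ^ 48 := by field_simp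
      have hbud : (D ^ B) ^ 2 * Q₀ ^ 2 * (|(a : ℝ)| + 1) * ℒ ^ A ≤ t := by
        refine hWsub _ ?_
        rw [hWdef]
        calc (D ^ B) ^ 2 * Q₀ ^ 2 * (|(a : ℝ)| + 1)
            = (D ^ B) ^ 2 * Q₀ ^ 2 * 1 * 1 * (|(a : ℝ)| + 1) * 1 := by ring
          _ ≤ Dp * Q₀ ^ 2 * SL ^ 2 * (3 * L₁ + 1) ^ 2 * (|(a : ℝ)| + 1) *
              (15 * Real.sqrt (3 * CE * (x ^ 3) ^ ηE) + 1) := by gcongr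
      calc 192 * (D ^ B) ^ 2 * (8 * π * |(a : ℝ)| * M * (H : ℝ) ^ 2 * Q₀ ^ 2 / (Q ^ 2 * R)) * R * ℒ ^ A
          = 1536 * π * ((D ^ B) ^ 2 * Q₀ ^ 2 * |(a : ℝ)| * ℒ ^ A) * (M * (H : ℝ) ^ 2) / Q ^ 2 := by
            field_simp
            ring
        _ ≤ 1536 * π * ((D ^ B) ^ 2 * Q₀ ^ 2 * (|(a : ℝ)| + 1) * ℒ ^ A) *
            (256 * t ^ 2 * Q ^ 4 * R ^ 2 / M) / Q ^ 2 := by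
            have ha1 : |(a : ℝ)| ≤ |(a : ℝ)| + 1 := by linarith only [abs_nonneg (a : ℝ)]
            gcongr
        _ ≤ 1536 * π * t * (256 * t ^ 2 * Q ^ 4 * R ^ 2 / M) / Q ^ 2 := by gcongr
        _ = 393216 * π * t ^ 3 * (Q ^ 2 * R ^ 2) / M := by field_simp; ring
        _ ≤ 393216 * π * t ^ 3 * (M ^ 2 / t ^ 48) / M := by gcongr
        _ = (393216 * π) * M / t ^ 45 := by field_simp
        _ ≤ t ^ 45 * x / t ^ 45 := by gcongr
        _ = x := by field_simp
  /- Step 6: `ℛ₁` through Lemma 6. -/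
  have hDpD1 : (D ^ B) ^ 2 * D ≤ Dp := by
    rw [hDp]
    refine mul_le_mul_of_nonneg_left ?_ (by positivity)
    calc D = D ^ 1 := (pow_one D).symm
      _ ≤ D ^ 3 := pow_le_pow_right₀ hσ1 (by norm_num)
  have h4NQ : 4 * N * Q ≤ Xd := by
    refine le_trans ?_ hXd
    calc 4 * N * Q ≤ 4 * x * x := by gcongr
      _ = 4 * x ^ 2 * 1 := by ring
      _ ≤ 8 * x ^ 2 * x := by nlinarith only [hx1, pow_pos hx0 2]
      _ = 8 * x ^ 3 := by ring
  have hT2 : ‖calR1 a M (M / 2) N Q R Q₀ β γ H‖ ≤ 1 * F := by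
    rw [one_mul]
    by_cases hH0 : H = 0
    · have hz0 : calR1 a M (M / 2) N Q R Q₀ β γ 0 = 0 := by
        unfold calR1
        refine Finset.sum_eq_zero fun r _ => Finset.sum_eq_zero fun q₁ _ =>
          Finset.sum_eq_zero fun q₂ _ => Finset.sum_eq_zero fun n₁ _ =>
            Finset.sum_eq_zero fun n₂ _ => ?_
        split_ifs
        · simp [oscR]
        · rfl
      rw [hH0, hz0, norm_zero]; exact hF0
    · -- `1 ≤ H ≤ 16 t Q² R / M`
      have hh1 : (1 : ℝ) ≤ (H : ℝ) := by exact_mod_cast Nat.one_le_iff_ne_zero.2 hH0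
      have hHle : (H : ℝ) ≤ 16 * t * Q ^ 2 * R / M := Nat.floor_le (by positivity)
      have hh : (H : ℝ) * M ≤ 16 * t * Q ^ 2 * R := by rwa [le_div_iff₀ hM0] at hHle
      obtain ⟨hP3, hPS⟩ := lemma6_box_le hx1 ht1 hbig hMN hM1 hN hQ hR h85 hii hiii hNQR hh1 hh
      set E : ℝ := CE * (x ^ 3) ^ ηE * (3 * N ^ 2 * Q ^ 3 / t ^ 2) with hEdef
      have hE0 : 0 ≤ E := by positivity
      have hP0 : 0 ≤ (4 * N * Q) * (2 * N) * (H : ℝ) * (2 * N / R) * (2 * Q) := by positivity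
      have hE : ∀ s ∈ ({1, -1} : Finset ℤ), ∀ α : ℕ → ℕ → ℂ, (∀ h' q, ‖α h' q‖ ≤ 1) →
          dispA (a * s) (4 * N * Q) (2 * N) (2 * N / R) (H : ℝ) (2 * Q) α ≤ E := by
        intro s hs α hα
        refine (hA6 (H : ℝ) hh1 s hs α hα).trans ?_
        simp only [← Real.sqrt_eq_rpow]
        rw [hEdef, mul_assoc CE]
        refine mul_le_mul_of_nonneg_left ?_ hCE
        refine mul_le_mul (Real.rpow_le_rpow hP0 hP3 hηE) hPS ?_ (by positivity)
        exact le_trans hP0 (le_add_of_nonneg_right (by positivity))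
      refine (calR1_le_struct hM0 hN hQ hR (by linarith only [hQ₀]) hB hσ1 hD h8Q2R h4NQ hγ β H
        hE0 hE).trans ?_
      -- `√(Q E) = √(3 C_E x^{3η}) · N Q² / t`
      have hsq : Real.sqrt (Q * E) = Real.sqrt (3 * CE * (x ^ 3) ^ ηE) * (N * Q ^ 2 / t) := by
        have e : Q * E = (3 * CE * (x ^ 3) ^ ηE) * (N * Q ^ 2 / t) ^ 2 := by
          rw [hEdef]; field_simp
        rw [e, Real.sqrt_mul (by positivity), Real.sqrt_sq (by positivity)]
      rw [hsq]
      set cR : ℝ := 15 * Real.sqrt (3 * CE * (x ^ 3) ^ ηE) * Q₀ ^ 2 * ((D ^ B) ^ 2 * D) with hcR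
      have hcRW : cR * ℒ ^ A ≤ t := by
        refine hWsub cR ?_
        rw [hcR, hWdef]
        have h15 : 15 * Real.sqrt (3 * CE * (x ^ 3) ^ ηE) ≤ 15 * Real.sqrt (3 * CE * (x ^ 3) ^ ηE) + 1 := by
          linarith only []
        calc 15 * Real.sqrt (3 * CE * (x ^ 3) ^ ηE) * Q₀ ^ 2 * ((D ^ B) ^ 2 * D)
            = ((D ^ B) ^ 2 * D) * Q₀ ^ 2 * 1 * 1 * 1 * (15 * Real.sqrt (3 * CE * (x ^ 3) ^ ηE)) := by ring
          _ ≤ Dp * Q₀ ^ 2 * SL ^ 2 * (3 * L₁ + 1) ^ 2 * (|(a : ℝ)| + 1) *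
              (15 * Real.sqrt (3 * CE * (x ^ 3) ^ ηE) + 1) := by gcongr
      have e2 : 15 * M * Q₀ ^ 2 * ((D ^ B) ^ 2 * D) * l2Sq N β *
          (Real.sqrt (3 * CE * (x ^ 3) ^ ηE) * (N * Q ^ 2 / t)) / (Q ^ 2 * R) = (cR * (x / (t * R))) * l2Sq N β := by
        rw [hcR, ← hMN]; field_simp
      rw [e2]
      refine hconv _ (by positivity) ?_
      calc cR * (x / (t * R)) * R * ℒ ^ A = (cR * ℒ ^ A) * x / t := by field_simp
        _ ≤ t * x / t := by gcongr
        _ = x := by field_simp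
  /- Step 7: `𝒳 − X` through Theorem 0 (a). -/
  have hz0 : 0 < z := by linarith only [hz]
  have hlogN : 0 < Real.log N := Real.log_pos (by linarith only [htN, ht8])
  set Cbe : ℝ := Cb / (Q₀ * SL ^ 2 * ℒ ^ A) with hCbe
  have hCbe0 : 0 ≤ Cbe := by positivity
  have hBDH' : ∀ d : ℕ, 1 ≤ d → ∑ q ∈ Finset.Icc 1 ⌊2 * Q₀ * R⌋₊, bdhD N β d q ≤
      Cbe * (σ 0 d : ℝ) ^ B * l2Sq N β * N / Real.log N ^ (0 : ℝ) := by
    intro d hd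
    rw [Real.rpow_zero, div_one]
    refine (hBDH d hd).trans (le_of_eq ?_)
    rw [hCbe]; field_simp
  have hLg : ((Nat.log 2 ⌊2 * N⌋₊ : ℕ) : ℝ) ≤ 2 * L₁ := by
    -- through a member of the (nonempty) dyadic range is not needed: direct computation
    have hfl : ⌊2 * N⌋₊ ≠ 0 := by
      have : (2 : ℝ) ≤ 2 * N := by linarith only [hN]
      have : 2 ≤ ⌊2 * N⌋₊ := Nat.le_floor (by exact_mod_cast this)
      omega
    refine (natLog_two_le_two_mul_log hfl).trans (mul_le_mul_of_nonneg_left ?_ (by norm_num))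
    rw [hL₁]
    refine Real.log_le_log (by exact_mod_cast Nat.pos_of_ne_zero hfl) ?_
    exact (Nat.floor_le (by positivity)).trans (by linarith only [hNx, hx0])
  have hLg0 : (0 : ℝ) ≤ ((Nat.log 2 ⌊2 * N⌋₊ : ℕ) : ℝ) := by positivity
  have hT1 : (M + 2 * (M / 2)) * ∑ r ∈ dyadic R, ∑ q₁ ∈ dyadic Q, ∑ q₂ ∈ dyadic Q,
      xErr N Q₀ z β γ r q₁ q₂ ≤ (2 * Cb + 3) * F := by
    refine (xErr_sum_le (A' := 0) hM0 hN hQ hR hQ₀ hz0 hB hk1 hlogN hSLQ hSLR hSL0 hCbe0 hγ β hBDH').trans ?_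
    rw [Real.rpow_zero, mul_one]
    have e : 2 * M * (Q₀ * SL ^ 2 * (Cbe * l2Sq N β * N / R) +
        l2Sq N β * (8 * N * (Nat.log 2 ⌊2 * N⌋₊ : ℕ) * SL ^ 2 / (z * R) +
          4 * Q₀ * (Nat.log 2 ⌊2 * N⌋₊ : ℕ) * SL ^ 2) +
        3 * N * l2Sq N β * SL ^ 3 / (R * Q₀)) =
        (2 * Cb) * F +
        (16 * (Nat.log 2 ⌊2 * N⌋₊ : ℕ) * SL ^ 2 * x / (z * R)) * l2Sq N β +
        (8 * M * Q₀ * (Nat.log 2 ⌊2 * N⌋₊ : ℕ) * SL ^ 2) * l2Sq N β +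
        (6 * SL ^ 3 * x / (R * Q₀)) * l2Sq N β := by
      rw [hF, hCbe, ← hMN]; field_simp; ring
    rw [e, show (2 * Cb + 3) * F = (2 * Cb) * F + 1 * F + 1 * F + 1 * F by ring]
    refine add_le_add (add_le_add (add_le_add le_rfl ?_) ?_) ?_
    · rw [one_mul]
      refine hconv _ (by positivity) ?_
      have hz1 : 48 * L₁ * SL ^ 2 * ℒ ^ A ≤ z := by
        refine le_trans ?_ hzbig
        rw [add_mul]
        exact le_add_of_nonneg_right (by positivity)
      calc 16 * (Nat.log 2 ⌊2 * N⌋₊ : ℕ) * SL ^ 2 * x / (z * R) * R * ℒ ^ A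
          = (16 * (Nat.log 2 ⌊2 * N⌋₊ : ℕ) * SL ^ 2 * ℒ ^ A) * x / z := by field_simp
        _ ≤ (16 * (2 * L₁) * SL ^ 2 * ℒ ^ A) * x / z := by gcongr
        _ ≤ z * x / z := by
            gcongr
            calc 16 * (2 * L₁) * SL ^ 2 * ℒ ^ A = 32 * L₁ * SL ^ 2 * ℒ ^ A := by ring
              _ ≤ 48 * L₁ * SL ^ 2 * ℒ ^ A := by gcongr; norm_num
              _ ≤ z := hz1
        _ = x := by field_simp
    · rw [one_mul]
      refine hconv _ (by positivity) ?_
      have hbud : Q₀ * L₁ * SL ^ 2 * ℒ ^ A ≤ t := by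
        refine hWsub _ ?_
        rw [hWdef]
        have hQ₀2 : Q₀ ≤ Q₀ ^ 2 := by nlinarith only [hQ₀]
        have hL2 : L₁ ≤ (3 * L₁ + 1) ^ 2 := by nlinarith only [hL₁1]
        calc Q₀ * L₁ * SL ^ 2 = 1 * Q₀ * SL ^ 2 * L₁ * 1 * 1 := by ring
          _ ≤ Dp * Q₀ ^ 2 * SL ^ 2 * (3 * L₁ + 1) ^ 2 * (|(a : ℝ)| + 1) *
              (15 * Real.sqrt (3 * CE * (x ^ 3) ^ ηE) + 1) := by gcongr
      have h7 : (16 : ℝ) ≤ t ^ 7 := le_trans (by norm_num) (htn 7 (by norm_num))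
      calc 8 * M * Q₀ * (Nat.log 2 ⌊2 * N⌋₊ : ℕ) * SL ^ 2 * R * ℒ ^ A
          = 8 * ((Nat.log 2 ⌊2 * N⌋₊ : ℕ) : ℝ) * (Q₀ * SL ^ 2 * ℒ ^ A) * (M * R) := by ring
        _ ≤ 8 * (2 * L₁) * (Q₀ * SL ^ 2 * ℒ ^ A) * (M * (N / t ^ 8)) := by gcongr
        _ = 16 * (Q₀ * L₁ * SL ^ 2 * ℒ ^ A) * x / t ^ 8 := by rw [← hMN]; field_simp; norm_num
        _ ≤ 16 * t * x / t ^ 8 := by gcongr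
        _ = 16 * x / t ^ 7 := by field_simp
        _ ≤ x := by rw [div_le_iff₀ (by positivity)]; nlinarith only [h7, hx0]
    · rw [one_mul]
      refine hconv _ (by positivity) ?_
      have hQ1 : 6 * SL ^ 3 * ℒ ^ A ≤ Q₀ := by
        refine le_trans ?_ hQ₀big
        rw [add_mul]
        exact le_add_of_nonneg_right (by positivity)
      calc 6 * SL ^ 3 * x / (R * Q₀) * R * ℒ ^ A = (6 * SL ^ 3 * ℒ ^ A) * x / Q₀ := by field_simp
        _ ≤ Q₀ * x / Q₀ := by gcongr
        _ = x := by field_simp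
  /- Step 8: `𝒮₁ⁿ` through Lemma 3 (twice) and the outer averaging. -/
  set ω₀ : ℝ := ((Nat.log 2 ⌊2 * N⌋₊ : ℕ) : ℝ) with hω₀def
  have hω₀0 : 0 ≤ ω₀ := by positivity
  have hω₀le : ω₀ ≤ 2 * L₁ := hLg
  have haM : (|a| : ℝ) < M - M / 2 := by linarith only [hat, htM]
  have hTD : 0 ≤ D ^ (B + 1) := by positivity
  have hX₀2 : X₀ ≤ 2 * (M - M / 2) * N := by
    rw [show 2 * (M - M / 2) * N = M * N by ring, hMN]; exact hX₀
  have hX₀'2 : X₀' ≤ 2 * M + M / 2 := by linarith only [hX₀', htM, hM0]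
  have hlev : ∀ m : ℕ, M - M / 2 < (m : ℝ) → (m : ℝ) ≤ 2 * M + M / 2 → ∀ t' : ℕ,
      (t' : ℝ) ≤ 2 * t ^ 2 * R → ((m * t' : ℕ) : ℝ) ≤ (2 * m * N) ^ (1 - ε₃) := by
    intro m hm1 hm2 t' ht'
    have hy1 : x ≤ 2 * m * N := by
      rw [← hMN]; nlinarith only [hm1, hN0]
    have hy2 : 2 * m * N ≤ 5 * x := by
      rw [← hMN]; nlinarith only [hm2, hN0]
    refine le_trans ?_ (hpow1 _ hy1 hy2)
    have ht5 : (5 : ℝ) ≤ t ^ 5 := le_trans (by norm_num) (htn 5 (by norm_num))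
    have hm0 : (0 : ℝ) ≤ m := by positivity
    have h1 : ((m * t' : ℕ) : ℝ) ≤ (2 * M + M / 2) * (2 * t ^ 2 * R) := by
      push_cast; exact mul_le_mul hm2 ht' (by positivity) (by positivity)
    refine h1.trans ?_
    rw [le_div_iff₀ ht0]
    -- `5 t³ M R ≤ x ≤ 2 m N`
    have h2 : (2 * M + M / 2) * (2 * t ^ 2 * R) * t = 5 * t ^ 3 * (M * R) := by ring
    rw [h2]
    have h3 : M * R ≤ M * (N / t ^ 8) := mul_le_mul_of_nonneg_left hRN' hM0.le
    calc 5 * t ^ 3 * (M * R) ≤ 5 * t ^ 3 * (M * (N / t ^ 8)) := by gcongr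
      _ = 5 * x / t ^ 5 := by rw [← hMN]; field_simp
      _ ≤ x := by rw [div_le_iff₀ (by positivity)]; nlinarith only [ht5, hx0]
      _ ≤ 2 * m * N := hy1
  have hlev' : ∀ k : ℕ, (k : ℝ) ≤ 4 * Q * R → (k : ℝ) ≤ (2 * M + M / 2) ^ (1 - ε₃') := by
    intro k hk
    have hy1 : (1 : ℝ) ≤ 2 * M + M / 2 := by linarith only [hM1]
    have hy2 : 2 * M + M / 2 ≤ 3 * x := by linarith only [hMx, hM0]
    refine le_trans ?_ (hpow2 _ hy1 hy2)
    refine hk.trans ?_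
    rw [le_div_iff₀ (by positivity)]
    have h16 : (4 : ℝ) ≤ t ^ 16 := le_trans (by norm_num) (htn 16 (by norm_num))
    calc 4 * Q * R * (2 * t ^ 8) = 8 * t ^ 8 * (Q * R) := by ring
      _ ≤ 8 * t ^ 8 * (M / t ^ 24) := by gcongr
      _ = 8 * M / t ^ 16 := by field_simp
      _ ≤ 2 * M := by rw [div_le_iff₀ (by positivity)]; nlinarith only [h16, hM0]
      _ ≤ 2 * M + M / 2 := by linarith only [hM0]
  have hTv : ∀ m : ℕ, (m : ℝ) ≤ 2 * M + M / 2 → ∀ n ∈ dyadic N,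
      (σ 0 (((m * n : ℕ) : ℤ) - a).toNat : ℝ) ^ (B + 1) ≤ D ^ (B + 1) := by
    intro m hm n hn
    set v : ℕ := (((m * n : ℕ) : ℤ) - a).toNat with hv
    by_cases hv0 : v = 0
    · rw [hv0, ArithmeticFunction.map_zero, Nat.cast_zero, Real.zero_rpow (by linarith only [hB])]
      exact hTD
    · refine Real.rpow_le_rpow (by positivity) (hD v hv0 ?_) (by linarith only [hB])
      have hn2 := dyadic_le_two_mul hN0.le hn
      have hvZ : (v : ℤ) = ((m * n : ℕ) : ℤ) - a := by
        rw [hv]; have := Nat.pos_of_ne_zero hv0; rw [hv] at this; omega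
      have hvR : (v : ℝ) = (m : ℝ) * n - a := by
        have : ((v : ℤ) : ℝ) = (((m * n : ℕ) : ℤ) - a : ℤ) := by rw [hvZ]
        push_cast at this; linarith only [this]
      rw [hvR]
      have hm0 : (0 : ℝ) ≤ m := by positivity
      have ha' : -(a : ℝ) ≤ |(a : ℝ)| := neg_le_abs _
      have h1 : (m : ℝ) * n ≤ (2 * M + M / 2) * (2 * N) := mul_le_mul hm hn2 (by positivity) (by positivity)
      have h2 : (2 * M + M / 2) * (2 * N) = 5 * x := by rw [← hMN]; ring
      have h3 : |(a : ℝ)| ≤ x := by linarith only [hat, htM, hMx, hx0]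
      calc (m : ℝ) * n - a ≤ 5 * x + x := by linarith only [h1, h2, h3, ha']
        _ ≤ 8 * x ^ 3 := by nlinarith only [hx1, pow_pos hx0 2]
        _ ≤ Xd := hXd
  have hlg2 : ∀ m : ℕ, M - M / 2 < (m : ℝ) → (m : ℝ) ≤ 2 * M + M / 2 →
      0 ≤ Real.log (2 * m * N) ∧ Real.log (2 * m * N) ≤ L₁ := by
    intro m hm1 hm2
    have hy1 : x ≤ 2 * m * N := by rw [← hMN]; nlinarith only [hm1, hN0]
    have hy2 : 2 * m * N ≤ 5 * x := by rw [← hMN]; nlinarith only [hm2, hN0]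
    exact ⟨Real.log_nonneg (hx1.trans hy1), Real.log_le_log (by linarith only [hx0, hy1]) hy2⟩
  have hω : ∀ n ∈ dyadic N, (n.primeFactors.card : ℝ) ≤ ω₀ := fun n hn =>
    (card_primeFactors_le_of_mem_dyadic hN hn).1
  have hdS := abs_dS1n_le (a := a) (M := M) (Y := M / 2) (N := N) (Q := Q) (R := R) (Q₀ := Q₀) (B := B)
    (z := z) (by positivity) (by linarith only [hM0]) hM1 haM hN hQ0 hR0 (by linarith only [hQ₀]) hB hγ β
    hz0 hsift (C₃ := C₃) (B₃ := B₃) (X₀ := X₀) (ε₃ := ε₃) (C₄ := C₄) (B₄ := B₄) (X₀' := X₀')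
    (ε₃' := ε₃') (P₀ := t ^ 2) (T := D ^ (B + 1)) (lg := L₁) (ω₀ := ω₀) hC₃ hB₃ hC₄ (by positivity) hTD
    hω₀0 hL3 hL3' hX₀2 hX₀'2 hlev hlev' hTv hlg2 hω
  have hrhs := dS1n_rhs_le (k₀ := k₀) (M := M) (Y := M / 2) (N := N) hQ hR hB hD8 hγ hC₃ hB₃ hC₄ hB₄
    (P₀ := t ^ 2) (T := D ^ (B + 1)) (lg := L₁) (ω₀ := ω₀) (z := z) (Q₀ := Q₀) (by positivity) hTD hω₀0
    (by linarith only [hL₁1]) hz0 (by linarith only [hQ₀]) hN0.le (by linarith only [hM1]) hk2 hSLQ hSLR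
    hSL0 β
  have hT3 : |dS1n a (mRange M (M / 2)) N Q R Q₀ (fun m => bump M (M / 2) m) β γ| ≤ 10 * F := by
    refine (hdS.trans hrhs).trans ?_
    set X : ℝ := 2 * M + M / 2 with hXdef
    have hX1 : 1 ≤ X := by rw [hXdef]; linarith only [hM1]
    have hXx : X ≤ 5 * x := by rw [hXdef]; linarith only [hMx, hM0]
    have hlX0 : 0 ≤ Real.log X := Real.log_nonneg hX1
    have hlX : Real.log X ≤ L₁ := Real.log_le_log (by linarith only [hX1]) hXx
    have hlXB : Real.log X ^ B₄ ≤ L₁ ^ B₄ := Real.rpow_le_rpow hlX0 hlX hB₄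
    have hNX : N * X = 5 / 2 * x := by rw [hXdef, ← hMN]; ring
    have hDB1 : D ^ (B + 1) = D ^ B * D := Real.rpow_add_one hD0.ne' B
    rw [hDB1]
    -- budgets
    have hb1 : ω₀ * (D ^ B * D) * SL * ℒ ^ A ≤ t := by
      refine hWsub _ ?_
      rw [hWdef, hDp]
      have h1 : D ^ B * D ≤ (D ^ B) ^ 2 * D ^ 3 := by
        calc D ^ B * D = (D ^ B * 1) * (D * 1 * 1) := by ring
          _ ≤ (D ^ B * D ^ B) * (D * D * D) := by gcongr
          _ = (D ^ B) ^ 2 * D ^ 3 := by ring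
      have h2 : ω₀ ≤ (3 * L₁ + 1) ^ 2 := by nlinarith only [hω₀le, hL₁1, hω₀0]
      have h3 : SL ≤ SL ^ 2 := by nlinarith only [hSL1]
      calc ω₀ * (D ^ B * D) * SL = (D ^ B * D) * 1 * SL * ω₀ * 1 * 1 := by ring
        _ ≤ (D ^ B) ^ 2 * D ^ 3 * Q₀ ^ 2 * SL ^ 2 * (3 * L₁ + 1) ^ 2 * (|(a : ℝ)| + 1) *
            (15 * Real.sqrt (3 * CE * (x ^ 3) ^ ηE) + 1) := by gcongr
    have hb2 : ω₀ * ((D ^ B) ^ 2 * D) * ℒ ^ A ≤ t := by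
      refine hWsub _ ?_
      rw [hWdef]
      have h2 : ω₀ ≤ (3 * L₁ + 1) ^ 2 := by nlinarith only [hω₀le, hL₁1, hω₀0]
      calc ω₀ * ((D ^ B) ^ 2 * D) = ((D ^ B) ^ 2 * D) * 1 * 1 * ω₀ * 1 * 1 := by ring
        _ ≤ Dp * Q₀ ^ 2 * SL ^ 2 * (3 * L₁ + 1) ^ 2 * (|(a : ℝ)| + 1) *
            (15 * Real.sqrt (3 * CE * (x ^ 3) ^ ηE) + 1) := by gcongr
    have hb3 : (D ^ B * D) * SL * ℒ ^ A ≤ t := by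
      refine hWsub _ ?_
      rw [hWdef, hDp]
      have h1 : D ^ B * D ≤ (D ^ B) ^ 2 * D ^ 3 := by
        calc D ^ B * D = (D ^ B * 1) * (D * 1 * 1) := by ring
          _ ≤ (D ^ B * D ^ B) * (D * D * D) := by gcongr
          _ = (D ^ B) ^ 2 * D ^ 3 := by ring
      have h3 : SL ≤ SL ^ 2 := by nlinarith only [hSL1]
      calc (D ^ B * D) * SL = (D ^ B * D) * 1 * SL * 1 * 1 * 1 := by ring
        _ ≤ (D ^ B) ^ 2 * D ^ 3 * Q₀ ^ 2 * SL ^ 2 * (3 * L₁ + 1) ^ 2 * (|(a : ℝ)| + 1) *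
            (15 * Real.sqrt (3 * CE * (x ^ 3) ^ ηE) + 1) := by gcongr
    have hb4 : ((D ^ B) ^ 2 * D ^ 2) * ℒ ^ A ≤ t := le_trans (mul_le_mul_of_nonneg_right hDpD2 (by positivity)) wDp
    have hz2 : 15 * L₁ * C₃ * C₄ * (2 * L₁) ^ B₃ * L₁ ^ B₄ * SL ^ 2 * ℒ ^ A ≤ z := by
      refine le_trans ?_ hzbig
      rw [add_mul]
      exact le_add_of_nonneg_left (by positivity)
    have hQ2 : 5 * C₃ * C₄ * L₁ ^ B₃ * L₁ ^ B₄ * SL ^ 2 * ℒ ^ A ≤ Q₀ := by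
      refine le_trans ?_ hQ₀big
      rw [add_mul]
      exact le_add_of_nonneg_left (by positivity)
    -- numeric `t` facts
    have ht20 : (20 : ℝ) ≤ t := by nlinarith only [hbig, ht0]
    have ht7 : (10 : ℝ) ≤ t ^ 7 := le_trans (by norm_num) (htn 7 (by norm_num))
    have ht25 : (32 : ℝ) ≤ t ^ 25 := le_trans (by norm_num) (htn 25 (by norm_num))
    have ht31 : (16 : ℝ) ≤ t ^ 31 := le_trans (by norm_num) (htn 31 (by norm_num))
    have hNQR' : N * Q * R ≤ x / t ^ 24 := by rw [le_div_iff₀ (by positivity)]; exact hNQR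
    -- the ten pieces
    set Tc : ℝ := D ^ B * D * (2 * N / (t ^ 2 * R) + 1) with hTc
    have e : l2Sq N β *
        (ω₀ * C₃ * C₄ * (2 * N) * X * (2 * L₁) ^ B₃ * Real.log X ^ B₄ / z * SL * (SL / R) +
          ω₀ * Tc * (X * SL * 4 + D ^ B * (4 * Q) * (4 * R)) +
          C₃ * C₄ * (2 * N) * X * L₁ ^ B₃ * Real.log X ^ B₄ / Q₀ * SL * (SL / R) +
          Tc * (X * SL * 4 + D ^ B * D * (4 * Q) * (4 * R))) =
        (ω₀ * C₃ * C₄ * (2 * N) * X * (2 * L₁) ^ B₃ * Real.log X ^ B₄ * SL ^ 2 / (z * R)) * l2Sq N β +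
        (8 * ω₀ * (D ^ B * D) * SL * (N * X) / (t ^ 2 * R)) * l2Sq N β +
        (4 * ω₀ * (D ^ B * D) * SL * X) * l2Sq N β +
        (32 * ω₀ * ((D ^ B) ^ 2 * D) * (N * Q) / t ^ 2) * l2Sq N β +
        (16 * ω₀ * ((D ^ B) ^ 2 * D) * (Q * R)) * l2Sq N β +
        (C₃ * C₄ * (2 * N) * X * L₁ ^ B₃ * Real.log X ^ B₄ * SL ^ 2 / (Q₀ * R)) * l2Sq N β +
        (8 * (D ^ B * D) * SL * (N * X) / (t ^ 2 * R)) * l2Sq N β +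
        (4 * (D ^ B * D) * SL * X) * l2Sq N β +
        (32 * ((D ^ B) ^ 2 * D ^ 2) * (N * Q) / t ^ 2) * l2Sq N β +
        (16 * ((D ^ B) ^ 2 * D ^ 2) * (Q * R)) * l2Sq N β := by
      rw [hTc]; field_simp; ring
    rw [e, show (10 : ℝ) * F = F + F + F + F + F + F + F + F + F + F by ring]
    refine add_le_add (add_le_add (add_le_add (add_le_add (add_le_add (add_le_add (add_le_add
      (add_le_add (add_le_add ?_ ?_) ?_) ?_) ?_) ?_) ?_) ?_) ?_) ?_
    · -- Z₁
      refine hconv _ (by positivity) ?_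
      calc ω₀ * C₃ * C₄ * (2 * N) * X * (2 * L₁) ^ B₃ * Real.log X ^ B₄ * SL ^ 2 / (z * R) * R * ℒ ^ A
          = 2 * (ω₀ * C₃ * C₄ * (2 * L₁) ^ B₃ * Real.log X ^ B₄ * SL ^ 2 * ℒ ^ A) * (N * X) / z := by
            field_simp
        _ ≤ 2 * ((2 * L₁) * C₃ * C₄ * (2 * L₁) ^ B₃ * L₁ ^ B₄ * SL ^ 2 * ℒ ^ A) * (N * X) / z := by gcongr
        _ = (10 * L₁ * C₃ * C₄ * (2 * L₁) ^ B₃ * L₁ ^ B₄ * SL ^ 2 * ℒ ^ A) * x / z := by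
            rw [hNX]; ring
        _ ≤ (15 * L₁ * C₃ * C₄ * (2 * L₁) ^ B₃ * L₁ ^ B₄ * SL ^ 2 * ℒ ^ A) * x / z := by
            gcongr; norm_num
        _ ≤ z * x / z := by gcongr
        _ = x := by field_simp
    · -- Z₂
      refine hconv _ (by positivity) ?_
      calc 8 * ω₀ * (D ^ B * D) * SL * (N * X) / (t ^ 2 * R) * R * ℒ ^ A
          = 20 * (ω₀ * (D ^ B * D) * SL * ℒ ^ A) * x / t ^ 2 := by rw [hNX]; field_simp; ring
        _ ≤ 20 * t * x / t ^ 2 := by gcongr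
        _ = 20 * x / t := by field_simp
        _ ≤ x := by rw [div_le_iff₀ ht0]; nlinarith only [ht20, hx0]
    · -- Z₃
      refine hconv _ (by positivity) ?_
      calc 4 * ω₀ * (D ^ B * D) * SL * X * R * ℒ ^ A
          = 4 * (ω₀ * (D ^ B * D) * SL * ℒ ^ A) * (X * R) := by ring
        _ ≤ 4 * t * ((5 / 2 * M) * (N / t ^ 8)) := by
            refine mul_le_mul (mul_le_mul_of_nonneg_left hb1 (by norm_num)) ?_ (by positivity) (by positivity)
            exact mul_le_mul (by rw [hXdef]; linarith only [hM0]) hRN' hR0.le (by positivity)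
        _ = 10 * x / t ^ 7 := by rw [← hMN]; field_simp; ring
        _ ≤ x := by rw [div_le_iff₀ (by positivity)]; nlinarith only [ht7, hx0]
    · -- Z₄
      refine hconv _ (by positivity) ?_
      calc 32 * ω₀ * ((D ^ B) ^ 2 * D) * (N * Q) / t ^ 2 * R * ℒ ^ A
          = 32 * (ω₀ * ((D ^ B) ^ 2 * D) * ℒ ^ A) * (N * Q * R) / t ^ 2 := by field_simp
        _ ≤ 32 * t * (x / t ^ 24) / t ^ 2 := by gcongr
        _ = 32 * x / t ^ 25 := by field_simp
        _ ≤ x := by rw [div_le_iff₀ (by positivity)]; nlinarith only [ht25, hx0]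
    · -- Z₅
      refine hconv _ (by positivity) ?_
      calc 16 * ω₀ * ((D ^ B) ^ 2 * D) * (Q * R) * R * ℒ ^ A
          = 16 * (ω₀ * ((D ^ B) ^ 2 * D) * ℒ ^ A) * (Q * R) * R := by ring
        _ ≤ 16 * t * (M / t ^ 24) * (N / t ^ 8) := by gcongr
        _ = 16 * x / t ^ 31 := by rw [← hMN]; field_simp
        _ ≤ x := by rw [div_le_iff₀ (by positivity)]; nlinarith only [ht31, hx0]
    · -- Z₆
      refine hconv _ (by positivity) ?_
      calc C₃ * C₄ * (2 * N) * X * L₁ ^ B₃ * Real.log X ^ B₄ * SL ^ 2 / (Q₀ * R) * R * ℒ ^ A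
          = 2 * (C₃ * C₄ * L₁ ^ B₃ * Real.log X ^ B₄ * SL ^ 2 * ℒ ^ A) * (N * X) / Q₀ := by field_simp
        _ ≤ 2 * (C₃ * C₄ * L₁ ^ B₃ * L₁ ^ B₄ * SL ^ 2 * ℒ ^ A) * (N * X) / Q₀ := by gcongr
        _ = (5 * C₃ * C₄ * L₁ ^ B₃ * L₁ ^ B₄ * SL ^ 2 * ℒ ^ A) * x / Q₀ := by rw [hNX]; ring
        _ ≤ Q₀ * x / Q₀ := by gcongr
        _ = x := by field_simp
    · -- Z₇
      refine hconv _ (by positivity) ?_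
      calc 8 * (D ^ B * D) * SL * (N * X) / (t ^ 2 * R) * R * ℒ ^ A
          = 20 * ((D ^ B * D) * SL * ℒ ^ A) * x / t ^ 2 := by rw [hNX]; field_simp; ring
        _ ≤ 20 * t * x / t ^ 2 := by gcongr
        _ = 20 * x / t := by field_simp
        _ ≤ x := by rw [div_le_iff₀ ht0]; nlinarith only [ht20, hx0]
    · -- Z₈
      refine hconv _ (by positivity) ?_
      calc 4 * (D ^ B * D) * SL * X * R * ℒ ^ A = 4 * ((D ^ B * D) * SL * ℒ ^ A) * (X * R) := by ring
        _ ≤ 4 * t * ((5 / 2 * M) * (N / t ^ 8)) := by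
            refine mul_le_mul (mul_le_mul_of_nonneg_left hb3 (by norm_num)) ?_ (by positivity) (by positivity)
            exact mul_le_mul (by rw [hXdef]; linarith only [hM0]) hRN' hR0.le (by positivity)
        _ = 10 * x / t ^ 7 := by rw [← hMN]; field_simp; ring
        _ ≤ x := by rw [div_le_iff₀ (by positivity)]; nlinarith only [ht7, hx0]
    · -- Z₉
      refine hconv _ (by positivity) ?_
      calc 32 * ((D ^ B) ^ 2 * D ^ 2) * (N * Q) / t ^ 2 * R * ℒ ^ A
          = 32 * (((D ^ B) ^ 2 * D ^ 2) * ℒ ^ A) * (N * Q * R) / t ^ 2 := by field_simp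
        _ ≤ 32 * t * (x / t ^ 24) / t ^ 2 := by gcongr
        _ = 32 * x / t ^ 25 := by field_simp
        _ ≤ x := by rw [div_le_iff₀ (by positivity)]; nlinarith only [ht25, hx0]
    · -- Z₁₀
      refine hconv _ (by positivity) ?_
      calc 16 * ((D ^ B) ^ 2 * D ^ 2) * (Q * R) * R * ℒ ^ A
          = 16 * (((D ^ B) ^ 2 * D ^ 2) * ℒ ^ A) * (Q * R) * R := by ring
        _ ≤ 16 * t * (M / t ^ 24) * (N / t ^ 8) := by gcongr
        _ = 16 * x / t ^ 31 := by rw [← hMN]; field_simp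
        _ ≤ x := by rw [div_le_iff₀ (by positivity)]; nlinarith only [ht31, hx0]
  /- Step 9: total. -/
  have hK2 := one_le_derivConst 2
  have htot : dispG a M N Q R β γ ≤ (2 * Cb + 192 * (8 + derivConst 2) + 1745) * F := by
    refine hmain.trans ?_
    have : (2 * Cb + 192 * (8 + derivConst 2) + 1745) * F =
        (2 * Cb + 3) * F + 1 * F + 10 * F + 2 * F + 1729 * F + (192 * (8 + derivConst 2)) * F := by ring
    rw [this]
    exact add_le_add (add_le_add (add_le_add (add_le_add (add_le_add hT1 hT2) hT3) hT4) hT5) hT6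
  refine htot.trans (mul_le_mul_of_nonneg_right ?_ hF0)
  nlinarith only [hC₃, hC₄, mul_nonneg hC₃ hC₄]

end BFI

end Literature.NumberTheory.Sieve

namespace Literature.NumberTheory.Sieve

namespace BFI

/-! ### Tools for the choice of the parameters -/

open Filter in
/-- `K (log x)^p ≤ x^s` for all large `x` (`s > 0`). [folklore] -/
theorem eventually_const_mul_log_rpow_le_rpow (K p : ℝ) {s : ℝ} (hs : 0 < s) :
    ∀ᶠ x : ℝ in atTop, K * Real.log x ^ p ≤ x ^ s := by
  filter_upwards [eventually_log_rpow_le_rpow (p + 1) hs,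
    Real.tendsto_log_atTop.eventually_ge_atTop (max K 1)] with x h1 h2
  have hl1 : 1 ≤ Real.log x := (le_max_right _ _).trans h2
  have hl0 : 0 < Real.log x := by linarith
  calc K * Real.log x ^ p ≤ Real.log x * Real.log x ^ p :=
        mul_le_mul_of_nonneg_right ((le_max_left _ _).trans h2) (Real.rpow_nonneg hl0.le _)
    _ = Real.log x ^ (p + 1) := by rw [Real.rpow_add_one hl0.ne', mul_comm]
    _ ≤ x ^ s := h1

/-- `√y ≤ y + 1`. [folklore] -/
theorem sqrt_le_add_one {y : ℝ} (hy : 0 ≤ y) : Real.sqrt y ≤ y + 1 := by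
  calc Real.sqrt y ≤ Real.sqrt ((y + 1) ^ 2) := Real.sqrt_le_sqrt (by nlinarith)
    _ = y + 1 := Real.sqrt_sq (by linarith)

/-- `(ℓ^p)^n = ℓ^{p n}` for `ℓ ≥ 0`. [folklore] -/
theorem rpow_npow {ℓ : ℝ} (hℓ : 0 ≤ ℓ) (p : ℝ) (n : ℕ) : (ℓ ^ p) ^ n = ℓ ^ (p * n) := by
  rw [← Real.rpow_natCast, ← Real.rpow_mul hℓ]

/-- **The ranges of Theorem 1 in polynomial form** (p. 225 and (8.5)–(8.6) p. 227): with
`t = x^{ε'/8}`, `0 < ε' ≤ ε`, the hypotheses `x^ε ≤ N ≤ x^{1−ε}`, `x^ε R < N`,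
`N < x^{−ε} min{x^{1/2}Q^{−1/2}, x²Q^{−5}R^{−1}, xQ^{−2}R^{−1/2}}` give `t⁸ ≤ M, N`, `Rt⁸ ≤ N`,
`N²Q t¹⁶ ≤ x` ((8.5)), `N²Q⁴R t¹⁶ ≤ x²` ((ii)), `NQ⁵R t⁸ ≤ x²` ((iii)) and `NQR t²⁴ ≤ x`.
[cite: BombieriFriedlanderIwaniecActa1986, §8 Theorem 1 p. 225, (8.5)–(8.6) p. 227] -/
theorem theorem1_ranges {x ε ε' M N Q R : ℝ} (hx : 1 ≤ x) (hε'0 : 0 < ε') (hε'ε : ε' ≤ ε)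
    (hMN : M * N = x) (hN1 : x ^ ε ≤ N) (hN2 : N ≤ x ^ (1 - ε)) (hQ : 1 / 2 ≤ Q) (hR : 1 / 2 ≤ R)
    (hRN : x ^ ε * R < N)
    (h1 : N < x ^ (-ε) * (x ^ (1 / 2 : ℝ) * Q ^ (-(1 / 2) : ℝ)))
    (h2 : N < x ^ (-ε) * (x ^ 2 * Q ^ (-5 : ℝ) * R⁻¹))
    (h3 : N < x ^ (-ε) * (x * Q ^ (-2 : ℝ) * R ^ (-(1 / 2) : ℝ))) :
    1 ≤ N ∧ (x ^ (ε' / 8)) ^ 8 ≤ M ∧ (x ^ (ε' / 8)) ^ 8 ≤ N ∧ R * (x ^ (ε' / 8)) ^ 8 ≤ N ∧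
      N ^ 2 * Q * (x ^ (ε' / 8)) ^ 16 ≤ x ∧ N ^ 2 * Q ^ 4 * R * (x ^ (ε' / 8)) ^ 16 ≤ x ^ 2 ∧
      N * Q ^ 5 * R * (x ^ (ε' / 8)) ^ 8 ≤ x ^ 2 ∧ N * Q * R * (x ^ (ε' / 8)) ^ 24 ≤ x := by
  have hx0 : 0 < x := by linarith
  have hQ0 : 0 < Q := by linarith
  have hR0 : 0 < R := by linarith
  have hε0 : 0 < ε := hε'0.trans_le hε'ε
  have hxε : 1 ≤ x ^ ε := Real.one_le_rpow hx hε0.le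
  have hN : 1 ≤ N := hxε.trans hN1
  have hN0 : 0 < N := by linarith
  have e8 : (x ^ (ε' / 8)) ^ 8 = x ^ ε' := by
    rw [rpow_npow hx0.le]; congr 1; push_cast; ring
  have e16 : (x ^ (ε' / 8)) ^ 16 = x ^ (2 * ε') := by
    rw [rpow_npow hx0.le]; congr 1; push_cast; ring
  have e24 : (x ^ (ε' / 8)) ^ 24 = x ^ (3 * ε') := by
    rw [rpow_npow hx0.le]; congr 1; push_cast; ring
  have hmono : ∀ {u v : ℝ}, u ≤ v → x ^ u ≤ x ^ v := fun h => Real.rpow_le_rpow_of_exponent_le hx h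
  have hεε : x ^ ε' ≤ x ^ ε := hmono hε'ε
  have hM : x ^ ε ≤ M := by
    have hMdef : M = x / N := by rw [← hMN]; field_simp
    rw [hMdef, le_div_iff₀ hN0]
    calc x ^ ε * N ≤ x ^ ε * x ^ (1 - ε) := mul_le_mul_of_nonneg_left hN2 (by positivity)
      _ = x := by rw [← Real.rpow_add hx0]; norm_num
  have hRle : R ≤ N * x ^ (-ε) := by
    rw [Real.rpow_neg hx0.le, ← div_eq_mul_inv, le_div_iff₀ (by positivity), mul_comm]
    exact hRN.le
  -- the three upper bounds, squared where needed
  have hxe2 : x ^ (-ε) * x ^ (-ε) = x ^ (-(2 * ε)) := by rw [← Real.rpow_add hx0]; congr 1; ring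
  have hx22 : x ^ (1 / 2 : ℝ) * x ^ (1 / 2 : ℝ) = x := by
    rw [← Real.rpow_add hx0, show (1 / 2 : ℝ) + 1 / 2 = 1 by norm_num, Real.rpow_one]
  have hQm : Q ^ (-(1 / 2) : ℝ) * Q ^ (-(1 / 2) : ℝ) = Q⁻¹ := by
    rw [← Real.rpow_add hQ0, show (-(1 / 2) : ℝ) + -(1 / 2) = -1 by norm_num, Real.rpow_neg_one]
  have hRm : R ^ (-(1 / 2) : ℝ) * R ^ (-(1 / 2) : ℝ) = R⁻¹ := by
    rw [← Real.rpow_add hR0, show (-(1 / 2) : ℝ) + -(1 / 2) = -1 by norm_num, Real.rpow_neg_one]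
  have hQ4 : Q ^ (-2 : ℝ) * Q ^ (-2 : ℝ) * Q ^ 4 = 1 := by
    rw [← Real.rpow_add hQ0, show (-2 : ℝ) + -2 = -((4 : ℕ) : ℝ) by norm_num, Real.rpow_neg hQ0.le,
      Real.rpow_natCast, inv_mul_cancel₀ (by positivity)]
  have hQ5 : Q ^ (-5 : ℝ) * Q ^ 5 = 1 := by
    rw [show (-5 : ℝ) = -((5 : ℕ) : ℝ) by norm_num, Real.rpow_neg hQ0.le, Real.rpow_natCast,
      inv_mul_cancel₀ (by positivity)]
  have sq1 : N ^ 2 * Q ≤ x ^ (-(2 * ε)) * x := by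
    have h := mul_lt_mul'' h1 h1 hN0.le hN0.le
    have e : x ^ (-ε) * (x ^ (1 / 2 : ℝ) * Q ^ (-(1 / 2) : ℝ)) *
        (x ^ (-ε) * (x ^ (1 / 2 : ℝ) * Q ^ (-(1 / 2) : ℝ))) = x ^ (-(2 * ε)) * x * Q⁻¹ := by
      calc _ = (x ^ (-ε) * x ^ (-ε)) * (x ^ (1 / 2 : ℝ) * x ^ (1 / 2 : ℝ)) *
            (Q ^ (-(1 / 2) : ℝ) * Q ^ (-(1 / 2) : ℝ)) := by ring
        _ = _ := by rw [hxe2, hx22, hQm]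
    rw [e] at h
    calc N ^ 2 * Q = N * N * Q := by ring
      _ ≤ x ^ (-(2 * ε)) * x * Q⁻¹ * Q := mul_le_mul_of_nonneg_right h.le hQ0.le
      _ = x ^ (-(2 * ε)) * x := by field_simp
  have sq3 : N ^ 2 * Q ^ 4 * R ≤ x ^ (-(2 * ε)) * x ^ 2 := by
    have h := mul_lt_mul'' h3 h3 hN0.le hN0.le
    have e : x ^ (-ε) * (x * Q ^ (-2 : ℝ) * R ^ (-(1 / 2) : ℝ)) *
        (x ^ (-ε) * (x * Q ^ (-2 : ℝ) * R ^ (-(1 / 2) : ℝ))) =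
          x ^ (-(2 * ε)) * x ^ 2 * (Q ^ (-2 : ℝ) * Q ^ (-2 : ℝ)) * R⁻¹ := by
      calc _ = (x ^ (-ε) * x ^ (-ε)) * x ^ 2 * (Q ^ (-2 : ℝ) * Q ^ (-2 : ℝ)) *
            (R ^ (-(1 / 2) : ℝ) * R ^ (-(1 / 2) : ℝ)) := by ring
        _ = _ := by rw [hxe2, hRm]
    rw [e] at h
    calc N ^ 2 * Q ^ 4 * R
        = N * N * Q ^ 4 * R := by ring
      _ ≤ x ^ (-(2 * ε)) * x ^ 2 * (Q ^ (-2 : ℝ) * Q ^ (-2 : ℝ)) * R⁻¹ * Q ^ 4 * R := by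
          have := mul_le_mul_of_nonneg_right (mul_le_mul_of_nonneg_right h.le (pow_nonneg hQ0.le 4)) hR0.le
          linarith [this]
      _ = x ^ (-(2 * ε)) * x ^ 2 * (Q ^ (-2 : ℝ) * Q ^ (-2 : ℝ) * Q ^ 4) * (R⁻¹ * R) := by ring
      _ = x ^ (-(2 * ε)) * x ^ 2 := by rw [hQ4, inv_mul_cancel₀ hR0.ne']; ring
  have sq2 : N * Q ^ 5 * R ≤ x ^ (-ε) * x ^ 2 := by
    calc N * Q ^ 5 * R ≤ x ^ (-ε) * (x ^ 2 * Q ^ (-5 : ℝ) * R⁻¹) * Q ^ 5 * R := by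
          have := mul_le_mul_of_nonneg_right (mul_le_mul_of_nonneg_right h2.le (pow_nonneg hQ0.le 5)) hR0.le
          linarith [this]
      _ = x ^ (-ε) * x ^ 2 * (Q ^ (-5 : ℝ) * Q ^ 5) * (R⁻¹ * R) := by ring
      _ = x ^ (-ε) * x ^ 2 := by rw [hQ5, inv_mul_cancel₀ hR0.ne']; ring
  have c2 : x ^ (-(2 * ε)) * x ^ (2 * ε) = 1 := by
    rw [← Real.rpow_add hx0, neg_add_cancel, Real.rpow_zero]
  have c1 : x ^ (-ε) * x ^ ε = 1 := by
    rw [← Real.rpow_add hx0, neg_add_cancel, Real.rpow_zero]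
  refine ⟨hN, ?_, ?_, ?_, ?_, ?_, ?_, ?_⟩
  · rw [e8]; exact hεε.trans hM
  · rw [e8]; exact hεε.trans hN1
  · rw [e8]
    calc R * x ^ ε' ≤ R * x ^ ε := mul_le_mul_of_nonneg_left hεε hR0.le
      _ = x ^ ε * R := mul_comm _ _
      _ ≤ N := hRN.le
  · rw [e16]
    calc N ^ 2 * Q * x ^ (2 * ε') ≤ (x ^ (-(2 * ε)) * x) * x ^ (2 * ε) :=
          mul_le_mul sq1 (hmono (by linarith)) (by positivity) (by positivity)
      _ = x ^ (-(2 * ε)) * x ^ (2 * ε) * x := by ring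
      _ = x := by rw [c2, one_mul]
  · rw [e16]
    calc N ^ 2 * Q ^ 4 * R * x ^ (2 * ε') ≤ (x ^ (-(2 * ε)) * x ^ 2) * x ^ (2 * ε) :=
          mul_le_mul sq3 (hmono (by linarith)) (by positivity) (by positivity)
      _ = x ^ (-(2 * ε)) * x ^ (2 * ε) * x ^ 2 := by ring
      _ = x ^ 2 := by rw [c2, one_mul]
  · rw [e8]
    calc N * Q ^ 5 * R * x ^ ε' ≤ (x ^ (-ε) * x ^ 2) * x ^ ε :=
          mul_le_mul sq2 hεε (by positivity) (by positivity)
      _ = x ^ (-ε) * x ^ ε * x ^ 2 := by ring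
      _ = x ^ 2 := by rw [c1, one_mul]
  · rw [e24]
    have hNQR : N * Q * R ≤ x ^ (-(2 * ε)) * x * x ^ (-ε) := by
      calc N * Q * R ≤ N * Q * (N * x ^ (-ε)) := mul_le_mul_of_nonneg_left hRle (by positivity)
        _ = N ^ 2 * Q * x ^ (-ε) := by ring
        _ ≤ x ^ (-(2 * ε)) * x * x ^ (-ε) := mul_le_mul_of_nonneg_right sq1 (by positivity)
    calc N * Q * R * x ^ (3 * ε') ≤ (x ^ (-(2 * ε)) * x * x ^ (-ε)) * x ^ (3 * ε) :=
          mul_le_mul hNQR (hmono (by linarith)) (by positivity) (by positivity)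
      _ = x * (x ^ (-(2 * ε)) * x ^ (-ε) * x ^ (3 * ε)) := by ring
      _ = x := by
          rw [← Real.rpow_add hx0, ← Real.rpow_add hx0, show -(2 * ε) + -ε + 3 * ε = 0 by ring,
            Real.rpow_zero, mul_one]

/-! ### Theorem 1 from Lemma 6, and from Lemma 1 -/

set_option maxHeartbeats 1600000 in -- ~45 hypotheses of `theorem1_struct` to discharge
/-- **Bombieri–Friedlander–Iwaniec 1986, Theorem 1 (§8, p. 225) from Lemma 6 (§8, (8.4), p. 227).**
The hypothesis is BFI's Lemma 6 verbatim ("Let `C, D, H, K, Q ≥ 1`, `a ≠ 0` and `ε > 0`. We then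
have `𝒜(C,D,K,H,Q) ≪ (CDHKQ)^ε {CDHKQ + H(KQ)^{1/2}(H+Q)^{1/2}[C(Q²+HKQ)(C+DQ²) + C²DQ√(Q²+HKQ)
+ D²HKQ³]^{1/2}}`, the constant implied in `≪` depending on `ε` and `a` only"), stated for
`BFI.dispA` and all `|α(h,q)| ≤ 1` — the same hypothesis as in
`BombieriFriedlanderIwaniecTheorem5_of_lemma6`; in the source it is a consequence of Lemma 1 =
Deshouillers–Iwaniec's Theorem 12, and `BFI.L6.dispA_le_of_lemma1` (`…Lemma6`) proves it from that.
Everything else — Linnik's dispersion method of §§3–8: the smoothing (§3), `𝒮₃` (§4), `𝒮₂` (§5),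
`𝒮₁` with the truncations (A₄) and Poisson summation (§6), the main term via Theorem 0 (a) (§7),
`ℛ₁` via (8.2), Lemma 3 (Shiu) and the divisor-sum numerics — is PROVED in the tree
(`…DispersionSmoothing`, `…DispersionS3`, `…DispersionS2`, `…DispersionS1`, `…DispersionS1Rest`,
`…DispersionMainTerm`, `…Theorem1R1`, `…Theorem1Terms`, `BFI.theorem1_struct`).  The parameters are
chosen as on pp. 220, 227: `ε' = min(ε, 1/100)`, `t = x^{ε'/8}`, `Q₀, N₀ = ℒ^{O(1)}` ((6.5)),
`H = ⌊16tQ²R/M⌋`. [cite: BombieriFriedlanderIwaniecActa1986, §8 Theorem 1 p. 225, Lemma 6 p. 227] -/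
theorem _root_.Literature.NumberTheory.Sieve.BombieriFriedlanderIwaniecTheorem1_of_lemma6
    (h6 : ∀ a : ℤ, a ≠ 0 → ∀ η : ℝ, 0 < η → ∃ C₆ : ℝ, ∀ C D K H Q : ℝ,
      1 ≤ C → 1 ≤ D → 1 ≤ K → 1 ≤ H → 1 ≤ Q → ∀ α : ℕ → ℕ → ℂ, (∀ h q, ‖α h q‖ ≤ 1) →
        BFI.dispA a C D K H Q α ≤ C₆ * ((C * D * H * K * Q) ^ η *
          (C * D * H * K * Q + H * (K * Q) ^ (1 / 2 : ℝ) * (H + Q) ^ (1 / 2 : ℝ) *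
            (C * (Q ^ 2 + H * K * Q) * (C + D * Q ^ 2) +
              C ^ 2 * D * Q * (Q ^ 2 + H * K * Q) ^ (1 / 2 : ℝ) +
                D ^ 2 * H * K * Q ^ 3) ^ (1 / 2 : ℝ)))) :
    BombieriFriedlanderIwaniecTheorem1 := by
  intro a ha ε hε A hA B hB Csw
  -- the working exponent `ε' = min(ε, 1/100)`
  set ε' : ℝ := min ε (1 / 100) with hε'def
  have hε'0 : 0 < ε' := lt_min hε (by norm_num)
  have hε'ε : ε' ≤ ε := min_le_left _ _
  have hε'1 : ε' ≤ 1 / 100 := min_le_right _ _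
  -- Lemma 3 (Shiu), twice
  obtain ⟨B₃, C₃, X₀, hL3⟩ :=
    BombieriFriedlanderIwaniecLemma3_holds a ha (B + 1) (by linarith only [hB]) (ε' / 16)
      (by positivity)
  set B₃' : ℝ := max B₃ 1 with hB₃'
  set C₃' : ℝ := max C₃ 0 with hC₃'
  have hB₃'0 : 0 < B₃' := lt_of_lt_of_le one_pos (le_max_right _ _)
  have hC₃'0 : 0 ≤ C₃' := le_max_right _ _
  obtain ⟨B₄, C₄, X₀', hL4⟩ :=
    BombieriFriedlanderIwaniecLemma3_holds a ha B₃' hB₃'0 (ε' / 2) (by positivity)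
  set B₄' : ℝ := max B₄ 0 with hB₄'
  set C₄' : ℝ := max C₄ 0 with hC₄'
  have hB₄'0 : 0 ≤ B₄' := le_max_right _ _
  have hC₄'0 : 0 ≤ C₄' := le_max_right _ _
  have hCC0 : 0 ≤ C₃' * C₄' := mul_nonneg hC₃'0 hC₄'0
  -- the divisor moments `∑ τ^{k₀}/n ≪ (log)^{c_S}`
  set k₀ : ℕ := ⌈2 * B + 2 + B₃' + B₄'⌉₊ with hk₀
  have hk₀le : 2 * B + 2 + B₃' + B₄' ≤ k₀ := Nat.le_ceil _
  obtain ⟨C_S, hC_S, hS⟩ := exists_sum_sigma_zero_pow_div_le_real k₀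
  set cS : ℕ := 2 ^ (k₀ + 1) with hcS
  -- the master polylog exponent and the exponents `A'` (Theorem 0 (a)) and `B₀` ((6.5))
  have hcS0 : (0 : ℝ) ≤ cS := Nat.cast_nonneg _
  set pM : ℝ := 3 * ((cS : ℝ) + 1) + 3 * B₃' + 3 * B₄' + A + 3 with hpM
  have hpM3 : 3 ≤ pM := by rw [hpM]; linarith only [hB₃'0, hB₄'0, hA, hcS0]
  have hpM1 : 1 ≤ pM := by linarith only [hpM3]
  have hpM0 : 0 < pM := by linarith only [hpM3]
  have hApM : A ≤ pM := by rw [hpM]; linarith only [hB₃'0, hB₄'0, hcS0]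
  have hB₃'pM : 3 * B₃' ≤ pM := by rw [hpM]; linarith only [hB₄'0, hcS0, hA]
  have hB₄'pM : 3 * B₄' ≤ pM := by rw [hpM]; linarith only [hB₃'0, hcS0, hA]
  have hcSpM : (cS : ℝ) + 1 ≤ pM := by rw [hpM]; linarith only [hB₃'0, hB₄'0, hA, hcS0]
  set A' : ℝ := 9 * pM with hA'
  have hA'0 : 0 < A' := by rw [hA']; positivity
  set B₀ : ℝ := 7 * pM with hB₀
  have hB₀0 : 0 ≤ B₀ := by rw [hB₀]; positivity
  -- Theorem 0 (a)
  obtain ⟨C₀ₐ, N₁, h0a⟩ := BombieriFriedlanderIwaniecTheorem0a hA'0 hB Csw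
  set Cb : ℝ := max C₀ₐ 0 / ε' ^ A' with hCb
  have hCb0 : 0 ≤ Cb := by rw [hCb]; positivity
  -- Lemma 6 for `a` and `−a`
  set ηE : ℝ := ε' / 120 with hηE
  have hηE0 : 0 < ηE := by rw [hηE]; positivity
  obtain ⟨C₆, hC₆⟩ := h6 a ha ηE hηE0
  obtain ⟨C₆', hC₆'⟩ := h6 (-a) (neg_ne_zero.2 ha) ηE hηE0
  set CE : ℝ := max (max C₆ C₆') 0 with hCE
  have hCE0 : 0 ≤ CE := le_max_right _ _
  -- the divisor bound `τ(n) ≤ C₀ n^{η_D/4}`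
  set ηD : ℝ := ε' / (40 * (2 * B + 3)) with hηD
  have hηD0 : 0 < ηD := by rw [hηD]; positivity
  obtain ⟨C₀, hC₀1, hC₀⟩ := exists_sigma_zero_le_mul_rpow (ε := ηD / 4) (by positivity)
  have hC₀0 : 0 ≤ C₀ := by linarith only [hC₀1]
  -- the decay order `j` and the constants of the numerics
  set j : ℕ := ⌈80 / ε'⌉₊ with hj
  have hj80 : 80 / ε' ≤ j := Nat.le_ceil _
  have hjε : 80 ≤ ε' * j := by rwa [div_le_iff₀' hε'0] at hj80
  have hj2 : 2 ≤ j := by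
    have h1 : (8000 : ℝ) ≤ 80 / ε' := by rw [le_div_iff₀ hε'0]; linarith only [hε'1]
    have h2 : (2 : ℝ) ≤ j := by linarith only [h1, hj80]
    exact_mod_cast h2
  have hKj := one_le_derivConst j
  set KQ : ℝ := 6 + 5 * C₃' * C₄' with hKQ
  have hKQ0 : 0 ≤ KQ := by rw [hKQ]; linarith only [hCC0]
  set KW : ℝ := 16 * KQ ^ 2 * (|(a : ℝ)| + 1) * (45 * CE + 16) with hKW
  have hKW0 : 0 ≤ KW := by rw [hKW]; positivity
  set KS : ℝ := C_S * 2 ^ cS + 1 with hKS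
  -- the threshold `x₀`
  obtain ⟨x₀, hx₀⟩ := Filter.eventually_atTop.1 <|
    (Filter.eventually_ge_atTop (max (max X₀ 3) 8)).and <|
    (Real.tendsto_log_atTop.eventually_ge_atTop (max (max KS 2) (48 + 15 * C₃' * C₄'))).and <|
    (eventually_const_mul_log_rpow_le_rpow 2 0 (show 0 < ε' / 8 by positivity)).and <|
    (eventually_const_mul_log_rpow_le_rpow ((10 : ℝ) ^ 7) 0 (show 0 < ε' / 4 by positivity)).and <|
    (eventually_const_mul_log_rpow_le_rpow (max (max X₀' 3) (max N₁ (2 * |(a : ℝ)| + 2))) 0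
      hε'0).and <|
    (eventually_const_mul_log_rpow_le_rpow (C₀ * 8 ^ (ηD / 4)) 0
      (show 0 < ηD / 4 by positivity)).and <|
    (eventually_const_mul_log_rpow_le_rpow (26112 * derivConst j) A one_pos).and <|
    (eventually_const_mul_log_rpow_le_rpow KW (15 * pM) (show 0 < 3 * ε' / 40 by positivity)).and
    (eventually_const_mul_log_rpow_le_rpow (2 * KQ) (5 * pM + (2 * A' + 4)) hε'0)
  refine ⟨B₀, 2 * Cb + 192 * (8 + derivConst 2) + 5000 + 40 * C₃' * C₄' + 1, x₀, ?_⟩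
  intro x hx M N Q R hMN hN1 hN2 hQ hR _hQR hRN h1 h2 h3 β hSW hsift γ hγ
  obtain ⟨hxge, hℓge, ev1, ev2, ev3, ev4, ev5, ev6, ev7⟩ := hx₀ x hx
  simp only [Real.rpow_zero, mul_one] at ev1 ev2 ev3 ev4
  /- basic quantities -/
  have hx8 : 8 ≤ x := (le_max_right _ _).trans hxge
  have hx3 : 3 ≤ x := by linarith only [hx8]
  have hx1 : 1 ≤ x := by linarith only [hx8]
  have hx0 : 0 < x := by linarith only [hx8]
  have hX₀x : max X₀ 3 ≤ x := (le_max_left _ _).trans hxge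
  set ℓ : ℝ := Real.log x with hℓdef
  have hℓ2 : 2 ≤ ℓ := ((le_max_right _ _).trans (le_max_left _ _)).trans hℓge
  have hℓ1 : 1 ≤ ℓ := by linarith only [hℓ2]
  have hℓ0 : 0 < ℓ := by linarith only [hℓ2]
  have hℓKS : KS ≤ ℓ := ((le_max_left _ _).trans (le_max_left _ _)).trans hℓge
  have hℓ48 : 48 + 15 * C₃' * C₄' ≤ ℓ := (le_max_right _ _).trans hℓge
  have hℓKQ : KQ ≤ ℓ := by rw [hKQ]; linarith only [hℓ48, hCC0]
  have hQ0 : 0 < Q := by linarith only [hQ]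
  have hR0 : 0 < R := by linarith only [hR]
  have hxmono : ∀ {u v : ℝ}, u ≤ v → x ^ u ≤ x ^ v := fun h =>
    Real.rpow_le_rpow_of_exponent_le hx1 h
  -- `t = x^{ε'/8}`
  set t : ℝ := x ^ (ε' / 8) with htdef
  have ht2 : 2 ≤ t := ev1
  have ht0 : 0 < t := by linarith only [ht2]
  have ht1 : 1 ≤ t := by linarith only [ht2]
  have e8 : t ^ 8 = x ^ ε' := by rw [htdef, rpow_npow hx0.le]; congr 1; push_cast; ring
  have hbig : (10 : ℝ) ^ 7 ≤ t ^ 2 := by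
    rw [htdef, rpow_npow hx0.le, show ε' / 8 * ((2 : ℕ) : ℝ) = ε' / 4 by push_cast; ring]
    exact ev2
  -- the ranges
  obtain ⟨hN, htM, htN, hRN', h85, hii, hiii, hNQR⟩ :=
    theorem1_ranges hx1 hε'0 hε'ε hMN hN1 hN2 hQ hR hRN h1 h2 h3
  have hN0 : 0 < N := by linarith only [hN]
  have hRNle : R ≤ N := by
    calc R = R * 1 := (mul_one R).symm
      _ ≤ R * t ^ 8 := mul_le_mul_of_nonneg_left (one_le_pow₀ ht1) hR0.le
      _ ≤ N := hRN'
  have hNx : N ≤ x := by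
    calc N ≤ x ^ (1 - ε) := hN2
      _ ≤ x ^ (1 : ℝ) := hxmono (by linarith only [hε])
      _ = x := Real.rpow_one x
  have hxε'N : x ^ ε' ≤ N := by rw [← e8]; exact htN
  have hat : 2 * |(a : ℝ)| + 2 ≤ t ^ 8 := by
    rw [e8]; exact ((le_max_right _ _).trans (le_max_right _ _)).trans ev3
  have hX₀'t : max X₀' 3 ≤ t ^ 8 := by rw [e8]; exact (le_max_left _ _).trans ev3
  have hN₁N : N₁ ≤ N := (((le_max_left _ _).trans (le_max_right _ _)).trans ev3).trans hxε'N
  /- the polylog quantities: `L₁ = log 5x`, `S_L`, `Q₀`, the master polylog `P = ℓ^{p_M}` -/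
  set L₁ : ℝ := Real.log (5 * x) with hL₁def
  have hL₁eq : L₁ = Real.log 5 + ℓ := by rw [hL₁def, Real.log_mul (by norm_num) hx0.ne']
  have hlog5 : Real.log 5 ≤ ℓ := Real.log_le_log (by norm_num) (by linarith only [hx8])
  have hlog50 : 0 < Real.log 5 := Real.log_pos (by norm_num)
  have hL₁ℓ : L₁ ≤ 2 * ℓ := by rw [hL₁eq]; linarith only [hlog5]
  have hL₁0 : 0 < L₁ := by rw [hL₁eq]; linarith only [hlog50, hℓ0]
  set SL : ℝ := C_S * Real.log (2 * x) ^ cS + 1 with hSLdef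
  have hlog2x : Real.log (2 * x) ≤ 2 * ℓ := by
    rw [Real.log_mul (by norm_num) hx0.ne']
    have : Real.log 2 ≤ ℓ := Real.log_le_log (by norm_num) (by linarith only [hx8])
    linarith only [this]
  have hlog2x0 : 0 ≤ Real.log (2 * x) := Real.log_nonneg (by linarith only [hx1])
  have hSL1 : 1 ≤ SL := by
    have : 0 ≤ C_S * Real.log (2 * x) ^ cS := by positivity
    rw [hSLdef]; linarith only [this]
  have hSL0 : 0 < SL := by linarith only [hSL1]
  set P : ℝ := ℓ ^ pM with hPdef
  have hP1 : 1 ≤ P := Real.one_le_rpow hℓ1 hpM0.le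
  have hP0 : 0 < P := by linarith only [hP1]
  have hℓpow : ∀ {u : ℝ}, u ≤ pM → ℓ ^ u ≤ P := fun h => Real.rpow_le_rpow_of_exponent_le hℓ1 h
  have hℓP : ℓ ≤ P := by simpa using hℓpow hpM1
  have hℓ2P : ℓ ^ 2 ≤ P := by
    have := hℓpow (u := 2) (by linarith only [hpM3])
    rwa [show (2 : ℝ) = ((2 : ℕ) : ℝ) by norm_num, Real.rpow_natCast] at this
  have hℓ3P : ℓ ^ 3 ≤ P := by
    have := hℓpow (u := 3) hpM3
    rwa [show (3 : ℝ) = ((3 : ℕ) : ℝ) by norm_num, Real.rpow_natCast] at this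
  have hℓℓ2 : 0 ≤ ℓ * (ℓ - 2) := mul_nonneg hℓ0.le (by linarith only [hℓ2])
  have hL₁ℓ2 : L₁ ≤ ℓ ^ 2 := by nlinarith only [hL₁ℓ, hℓℓ2]
  have hℓℓ3 : 0 ≤ ℓ * (ℓ - 2) * (ℓ + 2) := mul_nonneg hℓℓ2 (by linarith only [hℓ2])
  have h2L₁ℓ3 : 2 * L₁ ≤ ℓ ^ 3 := by nlinarith only [hL₁ℓ, hℓℓ3]
  have hL₁P : L₁ ≤ P := hL₁ℓ2.trans hℓ2P
  have hAP : ℓ ^ A ≤ P := hℓpow hApM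
  have hL₁rpow : ∀ {b : ℝ}, 0 ≤ b → 3 * b ≤ pM → L₁ ^ b ≤ P := by
    intro b hb hbp
    calc L₁ ^ b ≤ (ℓ ^ 2) ^ b := Real.rpow_le_rpow hL₁0.le hL₁ℓ2 hb
      _ = ℓ ^ (2 * b) := by rw [← Real.rpow_natCast, ← Real.rpow_mul hℓ0.le]; norm_num
      _ ≤ P := hℓpow (by linarith only [hb, hbp])
  have h2L₁rpow : ∀ {b : ℝ}, 0 ≤ b → 3 * b ≤ pM → (2 * L₁) ^ b ≤ P := by
    intro b hb hbp
    calc (2 * L₁) ^ b ≤ (ℓ ^ 3) ^ b := Real.rpow_le_rpow (by linarith only [hL₁0]) h2L₁ℓ3 hb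
      _ = ℓ ^ (3 * b) := by rw [← Real.rpow_natCast, ← Real.rpow_mul hℓ0.le]; norm_num
      _ ≤ P := hℓpow hbp
  have hL₁B₃ : L₁ ^ B₃' ≤ P := hL₁rpow hB₃'0.le hB₃'pM
  have hL₁B₄ : L₁ ^ B₄' ≤ P := hL₁rpow hB₄'0 hB₄'pM
  have h2L₁B₃ : (2 * L₁) ^ B₃' ≤ P := h2L₁rpow hB₃'0.le hB₃'pM
  have hSLP : SL ≤ P := by
    have h1 : Real.log (2 * x) ^ cS ≤ (2 * ℓ) ^ cS := pow_le_pow_left₀ hlog2x0 hlog2x cS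
    have h2 : (1 : ℝ) ≤ ℓ ^ cS := one_le_pow₀ hℓ1
    have h3 : (0 : ℝ) ≤ ℓ ^ cS := by positivity
    calc SL = C_S * Real.log (2 * x) ^ cS + 1 := rfl
      _ ≤ C_S * (2 * ℓ) ^ cS + ℓ ^ cS := add_le_add (mul_le_mul_of_nonneg_left h1 hC_S.le) h2
      _ = KS * ℓ ^ cS := by rw [hKS, mul_pow]; ring
      _ ≤ ℓ * ℓ ^ cS := mul_le_mul_of_nonneg_right hℓKS h3
      _ = ℓ ^ (((cS + 1 : ℕ) : ℝ)) := by rw [Real.rpow_natCast, pow_succ, mul_comm]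
      _ ≤ P := hℓpow (by push_cast; exact hcSpM)
  set Q₀ : ℝ := (6 * SL ^ 3 + 5 * C₃' * C₄' * L₁ ^ B₃' * L₁ ^ B₄' * SL ^ 2) * ℓ ^ A with hQ₀def
  have hℓA1 : 1 ≤ ℓ ^ A := Real.one_le_rpow hℓ1 hA.le
  have hQ₀1 : 1 ≤ Q₀ := by
    have h1 : 1 ≤ SL ^ 3 := one_le_pow₀ hSL1
    have h2 : 0 ≤ 5 * C₃' * C₄' * L₁ ^ B₃' * L₁ ^ B₄' * SL ^ 2 := by positivity
    exact one_le_mul_of_one_le_of_one_le (by linarith only [h1, h2]) hℓA1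
  have hQ₀0 : 0 < Q₀ := by linarith only [hQ₀1]
  have hQ₀P : Q₀ ≤ KQ * P ^ 5 := by
    have hP45 : P ^ 4 ≤ P ^ 5 := pow_le_pow_right₀ hP1 (by norm_num)
    calc Q₀ = (6 * SL ^ 3 + 5 * C₃' * C₄' * L₁ ^ B₃' * L₁ ^ B₄' * SL ^ 2) * ℓ ^ A := rfl
      _ ≤ (6 * P ^ 3 + 5 * C₃' * C₄' * P * P * P ^ 2) * P := by gcongr
      _ = 6 * P ^ 4 + 5 * C₃' * C₄' * P ^ 5 := by ring
      _ ≤ 6 * P ^ 5 + 5 * C₃' * C₄' * P ^ 5 := by linarith only [hP45]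
      _ = KQ * P ^ 5 := by rw [hKQ]; ring
  have hP9 : Q₀ * SL ^ 2 * ℓ ^ A ≤ ℓ ^ A' := by
    have h8 : (0 : ℝ) ≤ P ^ 8 := by positivity
    calc Q₀ * SL ^ 2 * ℓ ^ A ≤ (KQ * P ^ 5) * P ^ 2 * P := by gcongr
      _ = KQ * P ^ 8 := by ring
      _ ≤ P * P ^ 8 := mul_le_mul_of_nonneg_right (hℓKQ.trans hℓP) h8
      _ = P ^ 9 := by ring
      _ = ℓ ^ A' := by rw [hPdef, rpow_npow hℓ0.le, hA']; congr 1; push_cast; ring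
  have hzbig : (48 * L₁ * SL ^ 2 + 15 * L₁ * C₃' * C₄' * (2 * L₁) ^ B₃' * L₁ ^ B₄' * SL ^ 2) *
      ℓ ^ A ≤ ℓ ^ B₀ := by
    have hP46 : P ^ 4 ≤ P ^ 6 := pow_le_pow_right₀ hP1 (by norm_num)
    have h6 : (0 : ℝ) ≤ P ^ 6 := by positivity
    calc (48 * L₁ * SL ^ 2 + 15 * L₁ * C₃' * C₄' * (2 * L₁) ^ B₃' * L₁ ^ B₄' * SL ^ 2) * ℓ ^ A
        ≤ (48 * P * P ^ 2 + 15 * P * C₃' * C₄' * P * P * P ^ 2) * P := by gcongr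
      _ = 48 * P ^ 4 + 15 * C₃' * C₄' * P ^ 6 := by ring
      _ ≤ 48 * P ^ 6 + 15 * C₃' * C₄' * P ^ 6 := by linarith only [hP46]
      _ = (48 + 15 * C₃' * C₄') * P ^ 6 := by ring
      _ ≤ P * P ^ 6 := mul_le_mul_of_nonneg_right (hℓ48.trans hℓP) h6
      _ = P ^ 7 := by ring
      _ = ℓ ^ B₀ := by rw [hPdef, rpow_npow hℓ0.le, hB₀]; congr 1; push_cast; ring
  have hz1 : 1 ≤ ℓ ^ B₀ := Real.one_le_rpow hℓ1 hB₀0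
  /- the divisor-moment hypothesis -/
  have hSL : ∀ X : ℝ, 1 ≤ X → X ≤ 2 * x →
      ∑ n ∈ Finset.Icc 1 ⌊X⌋₊, (σ 0 n : ℝ) ^ k₀ / n ≤ SL := by
    intro X hX1 hX2
    rcases lt_or_ge X 2 with hX | hX
    · have hfl : ⌊X⌋₊ = 1 := by
        rw [Nat.floor_eq_iff (by linarith only [hX1])]; push_cast
        exact ⟨hX1, by linarith only [hX]⟩
      rw [hfl, Finset.Icc_self, Finset.sum_singleton,
        ArithmeticFunction.isMultiplicative_sigma.map_one]
      simp only [Nat.cast_one, one_pow, div_one]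
      exact hSL1
    · calc ∑ n ∈ Finset.Icc 1 ⌊X⌋₊, (σ 0 n : ℝ) ^ k₀ / n ≤ C_S * Real.log X ^ cS := hS X hX
        _ ≤ C_S * Real.log (2 * x) ^ cS :=
            mul_le_mul_of_nonneg_left (pow_le_pow_left₀ (Real.log_nonneg (by linarith only [hX]))
              (Real.log_le_log (by linarith only [hX]) hX2) cS) hC_S.le
        _ ≤ SL := by rw [hSLdef]; linarith only [hSL1]
  have hk1 : 2 * B + 2 ≤ (k₀ : ℝ) := by linarith only [hk₀le, hB₃'0, hB₄'0]
  have hk2 : B + 1 + B₃' + B₄' ≤ (k₀ : ℝ) := by linarith only [hk₀le, hB]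
  /- the divisor bound `τ(n) ≤ D = x^{η_D}` below `8x³`, and `(D^B)²D³ = x^{ε'/40}` -/
  have hx3r : (x ^ 3 : ℝ) = x ^ (3 : ℝ) := by
    rw [show (3 : ℝ) = ((3 : ℕ) : ℝ) by norm_num, Real.rpow_natCast]
  have hD : ∀ n : ℕ, n ≠ 0 → (n : ℝ) ≤ 8 * x ^ 3 → (σ 0 n : ℝ) ≤ x ^ ηD := by
    intro n _hn hnX
    have hn0 : (0 : ℝ) ≤ n := Nat.cast_nonneg _
    have hx30 : (0 : ℝ) ≤ 8 * x ^ 3 := by positivity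
    calc (σ 0 n : ℝ) ≤ C₀ * (n : ℝ) ^ (ηD / 4) := hC₀ n
      _ ≤ C₀ * (8 * x ^ 3) ^ (ηD / 4) :=
          mul_le_mul_of_nonneg_left (Real.rpow_le_rpow hn0 hnX (by positivity)) hC₀0
      _ = C₀ * 8 ^ (ηD / 4) * x ^ (3 * (ηD / 4)) := by
          rw [Real.mul_rpow (by norm_num) (by positivity), hx3r, ← Real.rpow_mul hx0.le]; ring
      _ ≤ x ^ (ηD / 4) * x ^ (3 * (ηD / 4)) := mul_le_mul_of_nonneg_right ev4 (by positivity)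
      _ = x ^ ηD := by rw [← Real.rpow_add hx0]; congr 1; ring
  have h23 : (40 : ℝ) * (2 * B + 3) ≠ 0 := by positivity
  have hDp : (((x ^ ηD) ^ B) ^ 2 * (x ^ ηD) ^ 3 : ℝ) = x ^ (ε' / 40) := by
    rw [← Real.rpow_mul hx0.le, rpow_npow hx0.le, rpow_npow hx0.le, ← Real.rpow_add hx0]
    congr 1
    push_cast
    rw [hηD]
    field_simp
  /- Lemma 3 in the shape of `theorem1_struct` -/
  have hlogX : ∀ {X : ℝ}, 3 ≤ X → 1 ≤ Real.log X := fun {X} hX => by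
    rw [Real.le_log_iff_exp_le (by linarith only [hX])]
    exact (le_of_lt Real.exp_one_lt_d9).trans (by norm_num; linarith only [hX])
  have hL3n : ∀ X : ℝ, max X₀ 3 ≤ X → ∀ k : ℕ, 0 < k → (k : ℝ) ≤ X ^ (1 - ε' / 16) →
      ∀ l : ZMod k, ∑ v ∈ l3Set a X k l, l3Term a (B + 1) v ≤
        C₃' * (X / k) * ((σ 0 k : ℝ) * Real.log X) ^ B₃' := by
    intro X hX k hk hkX l
    have h := hL3 X ((le_max_left _ _).trans hX) k hk hkX l
    have hX3 : 3 ≤ X := (le_max_right _ _).trans hX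
    have hb : 1 ≤ (σ 0 k : ℝ) * Real.log X := by
      have h1 : (1 : ℝ) ≤ (σ 0 k : ℝ) := by exact_mod_cast one_le_sigma_zero hk.ne'
      nlinarith only [hlogX hX3, h1]
    have hXk : 0 ≤ X / k := div_nonneg (by linarith only [hX3]) (Nat.cast_nonneg _)
    calc ∑ v ∈ l3Set a X k l, l3Term a (B + 1) v
        ≤ C₃ * (X / k) * ((σ 0 k : ℝ) * Real.log X) ^ B₃ := h
      _ ≤ C₃' * (X / k) * ((σ 0 k : ℝ) * Real.log X) ^ B₃ :=
          mul_le_mul_of_nonneg_right (mul_le_mul_of_nonneg_right (le_max_left _ _) hXk)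
            (Real.rpow_nonneg (zero_le_one.trans hb) _)
      _ ≤ C₃' * (X / k) * ((σ 0 k : ℝ) * Real.log X) ^ B₃' :=
          mul_le_mul_of_nonneg_left (Real.rpow_le_rpow_of_exponent_le hb (le_max_left _ _))
            (mul_nonneg hC₃'0 hXk)
  have hL3n' : ∀ X : ℝ, max X₀' 3 ≤ X → ∀ k : ℕ, 0 < k → (k : ℝ) ≤ X ^ (1 - ε' / 2) →
      ∀ l : ZMod k, ∑ v ∈ l3Set a X k l, l3Term a B₃' v ≤
        C₄' * (X / k) * ((σ 0 k : ℝ) * Real.log X) ^ B₄' := by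
    intro X hX k hk hkX l
    have h := hL4 X ((le_max_left _ _).trans hX) k hk hkX l
    have hX3 : 3 ≤ X := (le_max_right _ _).trans hX
    have hb : 1 ≤ (σ 0 k : ℝ) * Real.log X := by
      have h1 : (1 : ℝ) ≤ (σ 0 k : ℝ) := by exact_mod_cast one_le_sigma_zero hk.ne'
      nlinarith only [hlogX hX3, h1]
    have hXk : 0 ≤ X / k := div_nonneg (by linarith only [hX3]) (Nat.cast_nonneg _)
    calc ∑ v ∈ l3Set a X k l, l3Term a B₃' v
        ≤ C₄ * (X / k) * ((σ 0 k : ℝ) * Real.log X) ^ B₄ := h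
      _ ≤ C₄' * (X / k) * ((σ 0 k : ℝ) * Real.log X) ^ B₄ :=
          mul_le_mul_of_nonneg_right (mul_le_mul_of_nonneg_right (le_max_left _ _) hXk)
            (Real.rpow_nonneg (zero_le_one.trans hb) _)
      _ ≤ C₄' * (X / k) * ((σ 0 k : ℝ) * Real.log X) ^ B₄' :=
          mul_le_mul_of_nonneg_left (Real.rpow_le_rpow_of_exponent_le hb (le_max_left _ _))
            (mul_nonneg hC₄'0 hXk)
  have hx5t : (5 : ℝ) ^ (ε' / 16) ≤ x ^ (ε' / 16) :=
    Real.rpow_le_rpow (by norm_num) (by linarith only [hx8]) (by positivity)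
  have hpow1 : ∀ y : ℝ, x ≤ y → y ≤ 5 * x → y / t ≤ y ^ (1 - ε' / 16) := by
    intro y hy1 hy2
    have hy0 : 0 < y := by linarith only [hy1, hx0]
    rw [Real.rpow_sub hy0, Real.rpow_one]
    refine div_le_div_of_nonneg_left hy0.le (Real.rpow_pos_of_pos hy0 _) ?_
    calc y ^ (ε' / 16) ≤ (5 * x) ^ (ε' / 16) := Real.rpow_le_rpow hy0.le hy2 (by positivity)
      _ = 5 ^ (ε' / 16) * x ^ (ε' / 16) := Real.mul_rpow (by norm_num) hx0.le
      _ ≤ x ^ (ε' / 16) * x ^ (ε' / 16) := mul_le_mul_of_nonneg_right hx5t (by positivity)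
      _ = t := by rw [htdef, ← Real.rpow_add hx0]; congr 1; ring
  have hpow2 : ∀ y : ℝ, 1 ≤ y → y ≤ 3 * x → y / (2 * t ^ 8) ≤ y ^ (1 - ε' / 2) := by
    intro y hy1 hy2
    have hy0 : 0 < y := by linarith only [hy1]
    rw [Real.rpow_sub hy0, Real.rpow_one, e8]
    refine div_le_div_of_nonneg_left hy0.le (Real.rpow_pos_of_pos hy0 _) ?_
    have h3x : 3 * x ≤ x * x := by nlinarith only [hx3]
    have hxe : 0 ≤ x ^ ε' := by positivity
    calc y ^ (ε' / 2) ≤ (3 * x) ^ (ε' / 2) := Real.rpow_le_rpow hy0.le hy2 (by positivity)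
      _ ≤ (x * x) ^ (ε' / 2) := Real.rpow_le_rpow (by positivity) h3x (by positivity)
      _ = x ^ ε' := by rw [Real.mul_rpow hx0.le hx0.le, ← Real.rpow_add hx0]; congr 1; ring
      _ ≤ 2 * x ^ ε' := by linarith only [hxe]
  /- Theorem 0 (a) at level `2Q₀R` -/
  have hN256 : (2 : ℝ) ^ 8 ≤ N := by
    have h := pow_le_pow_left₀ (by norm_num : (0 : ℝ) ≤ 2) ht2 8
    exact h.trans htN
  have hlogN0 : 0 < Real.log N := Real.log_pos (by linarith only [hN256])
  have hlogNℓ : Real.log N ≤ ℓ := Real.log_le_log hN0 hNx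
  have hlogNε : ε' * ℓ ≤ Real.log N := by
    rw [hℓdef, ← Real.log_rpow hx0]; exact Real.log_le_log (by positivity) hxε'N
  have hP5 : 2 * (KQ * P ^ 5) * ℓ ^ (2 * A' + 4) = 2 * KQ * ℓ ^ (5 * pM + (2 * A' + 4)) := by
    rw [hPdef, rpow_npow hℓ0.le, show (5 : ℝ) * pM + (2 * A' + 4) = pM * ((5 : ℕ) : ℝ) +
      (2 * A' + 4) by push_cast; ring, Real.rpow_add hℓ0 (pM * ((5 : ℕ) : ℝ)) (2 * A' + 4)]
    ring
  have hlev : 2 * Q₀ * R ≤ N / Real.log N ^ (2 * A' + 4) := by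
    have h1 : 2 * Q₀ * ℓ ^ (2 * A' + 4) ≤ x ^ ε' := by
      calc 2 * Q₀ * ℓ ^ (2 * A' + 4) ≤ 2 * (KQ * P ^ 5) * ℓ ^ (2 * A' + 4) :=
            mul_le_mul_of_nonneg_right (mul_le_mul_of_nonneg_left hQ₀P (by norm_num))
              (Real.rpow_nonneg hℓ0.le _)
        _ = 2 * KQ * ℓ ^ (5 * pM + (2 * A' + 4)) := hP5
        _ ≤ x ^ ε' := ev7
    have hpos : 0 < Real.log N ^ (2 * A' + 4) := Real.rpow_pos_of_pos hlogN0 _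
    rw [le_div_iff₀ hpos]
    calc 2 * Q₀ * R * Real.log N ^ (2 * A' + 4) ≤ 2 * Q₀ * R * ℓ ^ (2 * A' + 4) :=
          mul_le_mul_of_nonneg_left (Real.rpow_le_rpow hlogN0.le hlogNℓ (by positivity))
            (by positivity)
      _ = (2 * Q₀ * ℓ ^ (2 * A' + 4)) * R := by ring
      _ ≤ x ^ ε' * R := mul_le_mul_of_nonneg_right h1 hR0.le
      _ = R * t ^ 8 := by rw [e8, mul_comm]
      _ ≤ N := hRN'
  have hBDH : ∀ d : ℕ, 1 ≤ d → ∑ q ∈ Finset.Icc 1 ⌊2 * Q₀ * R⌋₊, bdhD N β d q ≤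
      Cb * (σ 0 d : ℝ) ^ B * l2Sq N β * N / (Q₀ * SL ^ 2 * Real.log x ^ A) := by
    intro d hd
    have h := h0a N hN₁N β hSW d hd (2 * Q₀ * R) hlev
    have hl2 : 0 ≤ l2Sq N β := l2Sq_nonneg N β
    have hσ0 : 0 ≤ (σ 0 d : ℝ) ^ B := by positivity
    have hpos : 0 < Real.log N ^ A' := Real.rpow_pos_of_pos hlogN0 _
    have hεℓ : (ε' * ℓ) ^ A' ≤ Real.log N ^ A' := Real.rpow_le_rpow (by positivity) hlogNε hA'0.le
    have hε'A : ε' ^ A' ≠ 0 := (Real.rpow_pos_of_pos hε'0 _).ne'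
    have hℓA : ℓ ^ A' ≠ 0 := (Real.rpow_pos_of_pos hℓ0 _).ne'
    calc ∑ q ∈ Finset.Icc 1 ⌊2 * Q₀ * R⌋₊, bdhD N β d q
        ≤ C₀ₐ * (σ 0 d : ℝ) ^ B * l2Sq N β * N / Real.log N ^ A' := h
      _ ≤ max C₀ₐ 0 * (σ 0 d : ℝ) ^ B * l2Sq N β * N / Real.log N ^ A' :=
          div_le_div_of_nonneg_right (mul_le_mul_of_nonneg_right (mul_le_mul_of_nonneg_right
            (mul_le_mul_of_nonneg_right (le_max_left _ _) hσ0) hl2) hN0.le) hpos.le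
      _ ≤ max C₀ₐ 0 * (σ 0 d : ℝ) ^ B * l2Sq N β * N / (ε' * ℓ) ^ A' :=
          div_le_div_of_nonneg_left (by positivity) (by positivity) hεℓ
      _ = Cb * (σ 0 d : ℝ) ^ B * l2Sq N β * N / ℓ ^ A' := by
          rw [hCb, Real.mul_rpow hε'0.le hℓ0.le]
          field_simp
      _ ≤ Cb * (σ 0 d : ℝ) ^ B * l2Sq N β * N / (Q₀ * SL ^ 2 * Real.log x ^ A) :=
          div_le_div_of_nonneg_left (by positivity) (by positivity) hP9
  /- Lemma 6 on the boxes `(4NQ, 2N, 2N/R, h, 2Q)` -/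
  have hA6 : ∀ h : ℝ, 1 ≤ h → ∀ s ∈ ({1, -1} : Finset ℤ), ∀ α : ℕ → ℕ → ℂ,
      (∀ h' q, ‖α h' q‖ ≤ 1) →
      dispA (a * s) (4 * N * Q) (2 * N) (2 * N / R) h (2 * Q) α ≤
        CE * (((4 * N * Q) * (2 * N) * h * (2 * N / R) * (2 * Q)) ^ ηE *
          ((4 * N * Q) * (2 * N) * h * (2 * N / R) * (2 * Q) +
            h * ((2 * N / R) * (2 * Q)) ^ (1 / 2 : ℝ) * (h + 2 * Q) ^ (1 / 2 : ℝ) *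
              ((4 * N * Q) * ((2 * Q) ^ 2 + h * (2 * N / R) * (2 * Q)) *
                  ((4 * N * Q) + (2 * N) * (2 * Q) ^ 2) +
                (4 * N * Q) ^ 2 * (2 * N) * (2 * Q) *
                  ((2 * Q) ^ 2 + h * (2 * N / R) * (2 * Q)) ^ (1 / 2 : ℝ) +
                (2 * N) ^ 2 * h * (2 * N / R) * (2 * Q) ^ 3) ^ (1 / 2 : ℝ))) := by
    intro h hh s hs α hα
    have hh0 : 0 < h := by linarith only [hh]
    have hC1 : (1 : ℝ) ≤ 4 * N * Q := by nlinarith only [hN, hQ]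
    have hD1 : (1 : ℝ) ≤ 2 * N := by linarith only [hN]
    have hK1 : (1 : ℝ) ≤ 2 * N / R := by rw [le_div_iff₀ hR0]; linarith only [hRNle, hN0]
    have hQ1 : (1 : ℝ) ≤ 2 * Q := by linarith only [hQ]
    have hNR : 0 < 2 * N / R := by positivity
    simp only [Finset.mem_insert, Finset.mem_singleton] at hs
    rcases hs with rfl | rfl
    · rw [mul_one]
      exact (hC₆ _ _ _ _ _ hC1 hD1 hK1 hh hQ1 α hα).trans (mul_le_mul_of_nonneg_right
        ((le_max_left _ _).trans (le_max_left _ _)) (by positivity))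
    · rw [mul_neg_one]
      exact (hC₆' _ _ _ _ _ hC1 hD1 hK1 hh hQ1 α hα).trans (mul_le_mul_of_nonneg_right
        ((le_max_right _ _).trans (le_max_left _ _)) (by positivity))
  /- the numerics: tails, the budget `W` -/
  have hx2r : (x ^ 2 : ℝ) = x ^ (2 : ℝ) := by
    rw [show (2 : ℝ) = ((2 : ℕ) : ℝ) by norm_num, Real.rpow_natCast]
  have hx8r : (x ^ 8 : ℝ) = x ^ (8 : ℝ) := by
    rw [show (8 : ℝ) = ((8 : ℕ) : ℝ) by norm_num, Real.rpow_natCast]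
  have ev5' : 3072 * derivConst j * ℓ ^ A ≤ x ^ (1 : ℝ) := by
    refine le_trans ?_ ev5
    exact mul_le_mul_of_nonneg_right (by linarith only [hKj]) (by positivity)
  have htail1 : 3072 * derivConst j * (((x ^ ηD) ^ B) ^ 2 * (x ^ ηD) ^ 3) * x ^ 2 *
      Real.log x ^ A ≤ t ^ (22 * j) := by
    rw [hDp]
    calc 3072 * derivConst j * x ^ (ε' / 40) * x ^ 2 * ℓ ^ A
        = (3072 * derivConst j * ℓ ^ A) * (x ^ (ε' / 40) * x ^ 2) := by ring
      _ ≤ x ^ (1 : ℝ) * (x ^ (ε' / 40) * x ^ 2) := mul_le_mul_of_nonneg_right ev5' (by positivity)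
      _ = x ^ (3 + ε' / 40) := by
          rw [hx2r, ← Real.rpow_add hx0, ← Real.rpow_add hx0]; congr 1; ring
      _ ≤ x ^ (ε' / 8 * ((22 * j : ℕ) : ℝ)) := hxmono (by push_cast; linarith only [hjε, hε'0, hε'1])
      _ = t ^ (22 * j) := by rw [htdef, rpow_npow hx0.le]
  have htail2 : 26112 * derivConst j * (((x ^ ηD) ^ B) ^ 2 * (x ^ ηD) ^ 3) * x ^ 8 * t *
      Real.log x ^ A ≤ t ^ j := by
    rw [hDp]
    calc 26112 * derivConst j * x ^ (ε' / 40) * x ^ 8 * t * ℓ ^ A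
        = (26112 * derivConst j * ℓ ^ A) * (x ^ (ε' / 40) * x ^ 8 * t) := by ring
      _ ≤ x ^ (1 : ℝ) * (x ^ (ε' / 40) * x ^ 8 * t) := mul_le_mul_of_nonneg_right ev5 (by positivity)
      _ = x ^ (9 + ε' / 40 + ε' / 8) := by
          rw [hx8r, htdef, ← Real.rpow_add hx0, ← Real.rpow_add hx0, ← Real.rpow_add hx0]
          congr 1; ring
      _ ≤ x ^ (ε' / 8 * (j : ℝ)) := hxmono (by linarith only [hjε, hε'0, hε'1])
      _ = t ^ j := by rw [htdef, rpow_npow hx0.le]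
  have hx3ηE : ((x ^ 3) ^ ηE : ℝ) = x ^ (ε' / 40) := by
    rw [hx3r, ← Real.rpow_mul hx0.le]; congr 1; rw [hηE]; ring
  have hW : (((x ^ ηD) ^ B) ^ 2 * (x ^ ηD) ^ 3) * Q₀ ^ 2 * SL ^ 2 * (3 * Real.log (5 * x) + 1) ^ 2 *
      (|(a : ℝ)| + 1) * (15 * Real.sqrt (3 * CE * (x ^ 3) ^ ηE) + 1) * Real.log x ^ A ≤ t := by
    rw [hDp, hx3ηE]
    have hxe1 : (1 : ℝ) ≤ x ^ (ε' / 40) := Real.one_le_rpow hx1 (by positivity)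
    have hxe0 : (0 : ℝ) ≤ x ^ (ε' / 40) := by positivity
    have hsq : 15 * Real.sqrt (3 * CE * x ^ (ε' / 40)) + 1 ≤ (45 * CE + 16) * x ^ (ε' / 40) := by
      have h1 : Real.sqrt (3 * CE * x ^ (ε' / 40)) ≤ 3 * CE * x ^ (ε' / 40) + 1 :=
        sqrt_le_add_one (by positivity)
      nlinarith only [h1, hxe1, hCE0]
    have h3L : 3 * L₁ + 1 ≤ 4 * P := by linarith only [hL₁P, hP1]
    have hP15 : KW * P ^ 15 ≤ x ^ (3 * ε' / 40) := by
      calc KW * P ^ 15 = KW * ℓ ^ (15 * pM) := by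
            rw [hPdef, rpow_npow hℓ0.le]; congr 1; congr 1; push_cast; ring
        _ ≤ x ^ (3 * ε' / 40) := ev6
    have ha0 : 0 ≤ |(a : ℝ)| + 1 := by positivity
    calc x ^ (ε' / 40) * Q₀ ^ 2 * SL ^ 2 * (3 * L₁ + 1) ^ 2 * (|(a : ℝ)| + 1) *
          (15 * Real.sqrt (3 * CE * x ^ (ε' / 40)) + 1) * ℓ ^ A
        ≤ x ^ (ε' / 40) * (KQ * P ^ 5) ^ 2 * P ^ 2 * (4 * P) ^ 2 * (|(a : ℝ)| + 1) *
          ((45 * CE + 16) * x ^ (ε' / 40)) * P := by gcongr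
      _ = (KW * P ^ 15) * (x ^ (ε' / 40) * x ^ (ε' / 40)) := by rw [hKW]; ring
      _ ≤ x ^ (3 * ε' / 40) * (x ^ (ε' / 40) * x ^ (ε' / 40)) :=
          mul_le_mul_of_nonneg_right hP15 (by positivity)
      _ = t := by rw [htdef, ← Real.rpow_add hx0, ← Real.rpow_add hx0]; congr 1; ring
  /- the structural theorem -/
  have key := theorem1_struct a β γ (x := x) (t := t) (Q₀ := Q₀) (z := Real.log x ^ B₀)
    (D := x ^ ηD) (Xd := 8 * x ^ 3) (SL := SL) (ε₃ := ε' / 16) (ε₃' := ε' / 2) (Cb := Cb)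
    (CE := CE) (ηE := ηE) (X₀ := max X₀ 3) (X₀' := max X₀' 3) (C₃ := C₃') (B₃ := B₃')
    (C₄ := C₄') (B₄ := B₄') (A := A) (B := B) (k₀ := k₀) (j := j)
    hx3 ht2 hbig hMN hN htM htN hQ hR hRN' h85 hii hiii hNQR hA.le hB hγ hz1 hsift hQ₀1 hat
    hD le_rfl hSL hSL1 hk1 hk2 hC₃'0 hB₃'0.le hC₄'0 hB₄'0 hL3n hL3n' hX₀x hX₀'t hpow1 hpow2
    hCb0 hBDH hCE0 hηE0.le hA6 hj2 htail1 htail2 hW le_rfl hzbig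
  calc dispG a M N Q R β γ
      ≤ (2 * Cb + 192 * (8 + derivConst 2) + 5000 + 40 * C₃' * C₄' + 1) *
          (x * l2Sq N β / (R * Real.log x ^ A)) := key
    _ = (2 * Cb + 192 * (8 + derivConst 2) + 5000 + 40 * C₃' * C₄' + 1) * l2Sq N β * x * R⁻¹ /
          Real.log x ^ A := by
        rw [div_eq_mul_inv, div_eq_mul_inv, mul_inv]; ring

/-- **Bombieri–Friedlander–Iwaniec 1986, Theorem 1 (§8, p. 225) from Lemma 1 (§2, p. 210)** — i.e.
from the Deshouillers–Iwaniec bound for sums of Kloosterman sums (Invent. Math. 70 (1982),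
Theorem 12) in the form printed as BFI's Lemma 1, for the fixed smooth weight `w ⊗ w`
(`BFI.plateau2`, supported in `[1/4, 5/4]²`) and the ranges `C, D, N ≥ 1`, `R, S ≥ 1/2`
(hypothesis `BFI.Lemma1BoundFor BFI.plateau2 (5/4)` of `…Lemma6`).  PROVED: Lemma 6 from Lemma 1
is `BFI.L6.dispA_le_of_lemma1`, and Theorem 1 from Lemma 6 is the previous theorem.  What remains
unproved in the tree for the named fact `BombieriFriedlanderIwaniecTheorem1` is exactly Lemma 1.
[cite: BombieriFriedlanderIwaniecActa1986, §8 Theorem 1 p. 225; §2 Lemma 1 p. 210] -/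
theorem _root_.Literature.NumberTheory.Sieve.BombieriFriedlanderIwaniecTheorem1_of_lemma1
    (hLB : BFI.Lemma1BoundFor BFI.plateau2 (5 / 4)) : BombieriFriedlanderIwaniecTheorem1 :=
  BombieriFriedlanderIwaniecTheorem1_of_lemma6 (BFI.L6.dispA_le_of_lemma1 hLB)

end BFI

end Literature.NumberTheory.Sieve
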